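import Literature.Barriers.CriticalPhenomena.PositionSpaceRGNonGibbsianTorusTransfer
import Literature.Barriers.CriticalPhenomena.PositionSpaceRGNonGibbsianTorusTopology
import Mathlib.Algebra.Order.Field.GeomSum
import HarnessLib

/-!
# Blocks of the pinned torus, the chessboard–Peierls bound for long `-` paths, and the far bound in
# the `+`-exterior box

Support file for the Theorem 4.3 line of the barrier
`Literature/Barriers/CriticalPhenomena/PositionSpaceRGNonGibbsian.lean` (van Enter–Fernández–Sokal
1993, Theorem 4.3: the `+` phase of the internal spins with alternating frozen image spins, `b ≥ 3`;
the source's route is Pirogov–Sinai theory, §4.3.2 / App. B.5.3; this line of files replaces it by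
reflection positivity and a chessboard–Peierls argument on a torus — Fröhlich–Lieb 1978,
Friedli–Velenik 2017 §10.4, Biskup 2009 §5.3).

## Contents (namespace `Literature.Barriers.CriticalPhenomena.NonGibbs`), all proved

* **Blocks.** The block `t ∈ ℤ^d` of the torus `(ℤ/Nbℤ)^d` is the closed cube `[(t-1)b, (t+1)b]^d`,
  the union of the `2^d` cells with lower corners `cellsOf t = [t-1, t]`; it is BAD if one of its cells
  is bad (`BadBlock`), PLUS if it is not bad and the internal site `bt + e₀` carries `+1`
  (`PlusBlock`). Good cells of one block agree (`apply_eq_of_forall_not_badCell`, adjacent cells share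
  an internal site), so a plus block is `+1` at all its internal sites (`eq_one_of_plusBlock`) and a
  non-plus `★`-neighbour of a plus block is bad (`badBlock_of_adj_plusBlock`) — the structural
  hypothesis of the contour lemma `exists_starConn_bad_of_chain` (`…TorusTopology.lean`).
* **Bad blocks are improbable**: `tExpect_allBadInd_le_pow` — for a `★`-connected set `W` of at most
  `N - 2` blocks, the probability that all blocks of `W` are bad is at most `ε_blk^{#W}`,
  `ε_blk = 2^d · 2^{b^d} · e^{-β/4^d}` (choose a bad cell in each block; the cells are pairwise
  incongruent mod `N`; chessboard estimate `tExpect_prod_badInd_le_eps_pow` of `…TorusPeierls.lean`).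
* **Symmetries**: the pinned torus measure is invariant under the reflections through image
  hyperplanes and under `σ ↦ -σ(· - b eᵢ)` (`tExpect_comp_tRefl`, `tExpect_flipShift`); hence for a
  set `D` of blocks with `D ∪ (D + eᵢ)` `★`-connected and `D + 2eᵢ` a reflection of `D`,
  `P(all blocks of D plus) ≥ (1 - 2 #D ε_blk)/2` (`tExpect_plusAllInd_ge`).
* **The chessboard–Peierls bound** `tExpect_farInd_mul_plusAllInd_le`: the probability that a `-`
  path of internal spins joins a neighbour of the origin to sup-distance `> b(m'+2)` while all blocks
  of the cube of blocks `ballBlocks d y₀ r` are plus is at most `∑_W ε_blk^{#W}` over the three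
  contour families `famA ∪ famB ∪ famC` (bounded by `contourSum`: `sum_fam_le_contourSum`,
  `contourSum_le`).
* **The far bound in the box** `isingExpect_farInd_le`: in the volume `Λ^int_{R'}` with the
  boundary condition `η_p` of `VEFS1993_plusPhase`, the probability of such a `-` path is at most
  three times that sum (DLR–FKG comparison `isingExpect_mul_tExpect_le` of `…TorusTransfer.lean`, the
  plus cube `ballBlocks d (cubeCenter d _ R' r) r` being likely, `plusAllInd_ballBlocks_local`).

No named facts are introduced (D-0014, D-0026).

## References

* A. C. D. van Enter, R. Fernández, A. D. Sokal, J. Stat. Phys. 72 (1993) 879–1167, Theorem 4.3,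
  §4.3.1 Step 2, §4.3.2 [VanenterFernandezSokal1993].
* S. Friedli, Y. Velenik, *Statistical Mechanics of Lattice Systems*, CUP 2017, §10.4.2,
  Theorem 10.11, Lemma 7.19, Lemma 3.38 [FriedliVelenik2017].
* J. Fröhlich, R. Israel, E. H. Lieb, B. Simon, Comm. Math. Phys. 62 (1978) 1–34
  [FrohlichIsraelLiebSimon1978].
-/

noncomputable section

namespace Literature.Barriers.CriticalPhenomena.NonGibbs

open Finset Relation Literature.Probability.LatticeModels

variable {d : ℕ}

/-! ### Blocks -/

section Blocks

variable {N b : ℕ}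

/-- The `2^d` cells of the block `t`: lower corners `c ∈ [t - 1, t]`. [cite: FriedliVelenik2017, §10.4.2] -/
def cellsOf (t : Site d) : Finset (Site d) := Finset.Icc (t - 1) t

/-- Membership in `cellsOf`. [cite: FriedliVelenik2017, §10.4.2] -/
theorem mem_cellsOf {t c : Site d} : c ∈ cellsOf t ↔ ∀ i, t i - 1 ≤ c i ∧ c i ≤ t i := by
  rw [cellsOf, Finset.mem_Icc, Pi.le_def, Pi.le_def]
  simp only [Pi.sub_apply, Pi.one_apply]
  exact ⟨fun h i => ⟨h.1 i, h.2 i⟩, fun h => ⟨fun i => (h i).1, fun i => (h i).2⟩⟩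

/-- The top cell `t` belongs to the block `t`. [folklore] -/
theorem self_mem_cellsOf (t : Site d) : t ∈ cellsOf t := mem_cellsOf.2 fun i => ⟨by omega, le_rfl⟩

variable (N b) in
/-- **Bad blocks**: the block `[(t-1)b, (t+1)b]^d` of the torus is bad for `σ` if one of its `2^d`
cells is bad. [cite: FriedliVelenik2017, §10.4.2] -/
def BadBlock (t : Site d) (σ : SpinConfig (TorusSite d (N * b))) : Prop := ∃ c ∈ cellsOf t, BadCell N b c σ

variable (b) in
/-- The marked internal site `bt + e₀` of the block `t` (`d ≥ 1`). [folklore] -/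
def blockSite (hd : 0 < d) (t : Site d) : Site d := fun j => (b : ℤ) * t j + if j = ⟨0, hd⟩ then 1 else 0

variable (N b) in
/-- **Plus blocks**: not bad, and the marked internal site carries `+1`.
[cite: FriedliVelenik2017, §10.4.2] -/
def PlusBlock (hd : 0 < d) (t : Site d) (σ : SpinConfig (TorusSite d (N * b))) : Prop :=
  ¬ BadBlock N b t σ ∧ σ (Torus.proj (N * b) (blockSite b hd t)) = 1

/-- The marked site is an internal site of the top cell (`b ≥ 2`). [folklore] -/
theorem blockSite_mem_freeCellZ (hb : 2 ≤ b) (hd : 0 < d) (t : Site d) : blockSite b hd t ∈ freeCellZ b t := by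
  refine mem_freeCellZ.2 ⟨mem_cellZ.2 fun j => ?_, fun h => ?_⟩
  · have hbz : (2 : ℤ) ≤ b := by exact_mod_cast hb
    simp only [blockSite]; split_ifs <;> constructor <;> linarith
  · have := h ⟨0, hd⟩
    simp only [blockSite, if_true] at this
    have h1 : (b : ℤ) ∣ 1 := by simpa using dvd_sub this (dvd_mul_right (b : ℤ) (t ⟨0, hd⟩))
    have := Int.le_of_dvd one_pos h1
    omega

/-- **Adjacent cells of `ℤ^d` share an internal site** (`d ≥ 2`, `b ≥ 2`): `b(c + eᵢ) + e_j`, `j ≠ i`.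
[folklore] -/
theorem exists_mem_freeCellZ_inter (hd : 2 ≤ d) (hb : 2 ≤ b) (c : Site d) (i : Fin d) :
    ∃ y, y ∈ freeCellZ b c ∧ y ∈ freeCellZ b (c + Pi.single i 1) := by
  obtain ⟨j, hji⟩ : ∃ j : Fin d, j ≠ i := by
    have : Nontrivial (Fin d) := Fin.nontrivial_iff_two_le.2 hd
    exact exists_ne i
  have hbz : (2 : ℤ) ≤ b := by exact_mod_cast hb
  set c' : Site d := c + Pi.single i 1 with hc'
  have hc'i : c' i = c i + 1 := by simp [hc']
  have hc'k : ∀ k, k ≠ i → c' k = c k := fun k hk => by simp [hc', hk]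
  let y : Site d := fun k => (b : ℤ) * c' k + if k = j then 1 else 0
  have hyj : y j = (b : ℤ) * c' j + 1 := by simp [y]
  have hyk : ∀ k, k ≠ j → y k = (b : ℤ) * c' k := fun k hk => by simp [y, hk]
  have hfree : ¬ IsSpImageSite d b y := by
    intro h
    have := h j
    rw [hyj] at this
    have h1 : (b : ℤ) ∣ 1 := by simpa using dvd_sub this (dvd_mul_right (b : ℤ) (c' j))
    have := Int.le_of_dvd one_pos h1; omega
  refine ⟨y, mem_freeCellZ.2 ⟨mem_cellZ.2 fun k => ?_, hfree⟩, mem_freeCellZ.2 ⟨mem_cellZ.2 fun k => ?_, hfree⟩⟩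
  · by_cases hkj : k = j
    · subst hkj; rw [hyj, hc'k k hji]; constructor <;> linarith
    · rw [hyk k hkj]
      by_cases hki : k = i
      · subst hki; rw [hc'i]; constructor <;> nlinarith
      · rw [hc'k k hki]; constructor <;> nlinarith
  · by_cases hkj : k = j
    · subst hkj; rw [hyj]; constructor <;> linarith
    · rw [hyk k hkj]; constructor <;> nlinarith

/-- A good cell is constant on its internal sites. [folklore] -/
theorem apply_eq_of_not_badCell {c : Site d} {σ : SpinConfig (TorusSite d (N * b))} (h : ¬ BadCell N b c σ)
    {u v : Site d} (hu : u ∈ freeCellZ b c) (hv : v ∈ freeCellZ b c) :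
    σ (Torus.proj (N * b) u) = σ (Torus.proj (N * b) v) := by
  by_contra hne
  exact h ⟨u, hu, v, hv, hne⟩

/-- **Good cells of one block agree**: if no cell of the block `t` is bad, the configuration takes the
same value at all internal sites of all cells of the block. [cite: FriedliVelenik2017, §10.4.2] -/
theorem apply_eq_of_forall_not_badCell (hd : 2 ≤ d) (hb : 2 ≤ b) {t : Site d} {σ : SpinConfig (TorusSite d (N * b))}
    (h : ∀ c ∈ cellsOf t, ¬ BadCell N b c σ) {c : Site d} (hc : c ∈ cellsOf t) {y : Site d} (hy : y ∈ freeCellZ b c)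
    {y' : Site d} (hy' : y' ∈ freeCellZ b t) :
    σ (Torus.proj (N * b) y) = σ (Torus.proj (N * b) y') := by
  classical
  -- raise the coordinates of `c` to those of `t` one at a time
  set z : Finset (Fin d) → Site d := fun S i => if i ∈ S then t i else c i with hz
  have hzmem : ∀ S, z S ∈ cellsOf t := fun S => mem_cellsOf.2 fun i => by
    simp only [hz]; split_ifs
    · exact ⟨by omega, le_rfl⟩
    · exact (mem_cellsOf.1 hc) i
  -- the value on the cell `z S` is the value on the cell `c`
  have key : ∀ S : Finset (Fin d), ∀ w ∈ freeCellZ b (z S), σ (Torus.proj (N * b) w) = σ (Torus.proj (N * b) y) := by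
    intro S
    induction S using Finset.induction_on with
    | empty =>
      intro w hw
      have : z ∅ = c := funext fun i => by simp [hz]
      rw [this] at hw
      exact apply_eq_of_not_badCell (h c hc) hw hy
    | insert k S hkS ih =>
      intro w hw
      by_cases hck : c k = t k
      · have : z (insert k S) = z S := funext fun i => by
          by_cases hik : i = k
          · subst hik; simp [hz, hck]
          · simp [hz, hik]
        rw [this] at hw; exact ih w hw
      · have hck' : c k = t k - 1 := by have := (mem_cellsOf.1 hc) k; omega
        have hstep : z (insert k S) = z S + Pi.single k 1 := funext fun i => by
          by_cases hik : i = k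
          · subst hik; simp [hz, hkS, hck']
          · simp [hz, hik]
        obtain ⟨s, hs1, hs2⟩ := exists_mem_freeCellZ_inter hd hb (z S) k
        rw [← hstep] at hs2
        rw [apply_eq_of_not_badCell (h _ (hzmem _)) hw hs2, ← ih s hs1]
  have ht : z univ = t := funext fun i => by simp [hz]
  have h1 := key univ y' (by rw [ht]; exact hy')
  exact h1.symm

/-- **A plus block is `+1` at all internal sites of all its cells.** [cite: FriedliVelenik2017, §10.4.2] -/
theorem eq_one_of_plusBlock (hd : 2 ≤ d) (hb : 2 ≤ b) {t : Site d} {σ : SpinConfig (TorusSite d (N * b))}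
    (h : PlusBlock N b (by omega) t σ) {c : Site d} (hc : c ∈ cellsOf t) {y : Site d} (hy : y ∈ freeCellZ b c) :
    σ (Torus.proj (N * b) y) = 1 := by
  have hgood : ∀ c ∈ cellsOf t, ¬ BadCell N b c σ := fun c hc hbad => h.1 ⟨c, hc, hbad⟩
  rw [apply_eq_of_forall_not_badCell hd hb hgood hc hy (blockSite_mem_freeCellZ hb (by omega) t), h.2]

/-- `★`-adjacent blocks share a cell. [folklore] -/
theorem exists_mem_cellsOf_inter {t t' : Site d} (h : (zdStar d).Adj t t') : ∃ c, c ∈ cellsOf t ∧ c ∈ cellsOf t' := by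
  refine ⟨fun i => min (t i) (t' i), mem_cellsOf.2 fun i => ?_, mem_cellsOf.2 fun i => ?_⟩
  · have := natAbs_sub_le_one_of_adj h i
    constructor
    · rcases le_total (t i) (t' i) with hle | hle
      · rw [min_eq_left hle]; omega
      · rw [min_eq_right hle]; omega
    · exact min_le_left _ _
  · have := natAbs_sub_le_one_of_adj h i
    constructor
    · rcases le_total (t i) (t' i) with hle | hle
      · rw [min_eq_left hle]; omega
      · rw [min_eq_right hle]; omega
    · exact min_le_right _ _

/-- **A non-plus `★`-neighbour of a plus block is bad** (good blocks of opposite signs overlap in a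
cell). [cite: FriedliVelenik2017, §10.4.2] -/
theorem badBlock_of_adj_plusBlock (hd : 2 ≤ d) (hb : 2 ≤ b) {t t' : Site d} {σ : SpinConfig (TorusSite d (N * b))}
    (hadj : (zdStar d).Adj t t') (ht : PlusBlock N b (by omega) t σ) (ht' : ¬ PlusBlock N b (by omega) t' σ) :
    BadBlock N b t' σ := by
  by_contra hgood
  have hval : σ (Torus.proj (N * b) (blockSite b (by omega) t')) = -1 := by
    rcases Int.units_eq_one_or (σ (Torus.proj (N * b) (blockSite b (by omega) t'))) with h1 | h1
    · exact absurd ⟨hgood, h1⟩ ht'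
    · exact h1
  obtain ⟨c, hc, hc'⟩ := exists_mem_cellsOf_inter hadj
  obtain ⟨y, hy, -⟩ := exists_mem_freeCellZ_inter hd hb c ⟨0, by omega⟩
  have h1 : σ (Torus.proj (N * b) y) = 1 := eq_one_of_plusBlock hd hb ht hc hy
  have hgood' : ∀ c ∈ cellsOf t', ¬ BadCell N b c σ := fun c hc hbad => hgood ⟨c, hc, hbad⟩
  have h2 := apply_eq_of_forall_not_badCell hd hb hgood' hc' hy (blockSite_mem_freeCellZ hb (by omega) t')
  rw [h1, hval] at h2
  exact absurd h2 (by decide)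

/-- **Periodicity of bad blocks.** [cite: FriedliVelenik2017, §10.2] -/
theorem badBlock_add_period (t v : Site d) (σ : SpinConfig (TorusSite d (N * b))) :
    BadBlock N b (t + fun i => (N : ℤ) * v i) σ ↔ BadBlock N b t σ := by
  constructor
  · rintro ⟨c, hc, hbad⟩
    refine ⟨c - fun i => (N : ℤ) * v i, mem_cellsOf.2 fun i => ?_, ?_⟩
    · have := (mem_cellsOf.1 hc) i
      simp only [Pi.add_apply] at this
      simp only [Pi.sub_apply]
      omega
    · rwa [badCell_iff_of_dvd (c := c - fun i => (N : ℤ) * v i) (c' := c) (fun i => ⟨v i, by simp⟩)]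
  · rintro ⟨c, hc, hbad⟩
    refine ⟨c + fun i => (N : ℤ) * v i, mem_cellsOf.2 fun i => ?_, ?_⟩
    · have := (mem_cellsOf.1 hc) i
      simp only [Pi.add_apply]
      omega
    · rwa [← badCell_iff_of_dvd (c := c) (c' := c + fun i => (N : ℤ) * v i) (fun i => ⟨v i, by simp⟩)]

/-- The block of a site of `ℤ^d`: `⌊y / b⌋` coordinatewise. [folklore] -/
def blk (b : ℕ) (y : Site d) : Site d := fun i => y i / b

/-- A site lies in the top cell of its block (`b ≥ 1`). [folklore] -/
theorem mem_cellZ_blk (hb : 0 < b) (y : Site d) : y ∈ cellZ b (blk b y) := by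
  rw [mem_cellZ]; intro i
  have hbz : (0 : ℤ) < b := by exact_mod_cast hb
  have h1 := Int.emod_add_mul_ediv (y i) b
  have h2 := Int.emod_nonneg (y i) hbz.ne'
  have h3 := Int.emod_lt_of_pos (y i) hbz
  simp only [blk]
  constructor <;> linarith [mul_comm (b : ℤ) (y i / b)]

/-- Blocks of adjacent sites are equal or `★`-adjacent. [folklore] -/
theorem blk_adj_or_eq (hb : 0 < b) {y y' : Site d} (h : (zdGraph d).Adj y y') :
    blk b y = blk b y' ∨ (zdStar d).Adj (blk b y) (blk b y') := by
  by_cases heq : blk b y = blk b y'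
  · exact Or.inl heq
  · refine Or.inr (zdStar_adj_of_forall heq fun j => ?_)
    have hbz : (0 : ℤ) < b := by exact_mod_cast hb
    have hyj : |y' j - y j| ≤ 1 := abs_sub_le_one_of_zdGraph_adj h j
    simp only [blk]
    rw [abs_le] at hyj
    have h1 : y j / b ≤ (y' j + 1) / b := Int.ediv_le_ediv hbz (by linarith)
    have h2 : y' j / b ≤ (y j + 1) / b := Int.ediv_le_ediv hbz (by linarith)
    have h3 : (y' j + 1) / b ≤ y' j / b + 1 := by
      have := Int.add_mul_ediv_right (y' j) 1 hbz.ne'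
      have h4 : (y' j + 1) / b ≤ (y' j + 1 * b) / b := Int.ediv_le_ediv hbz (by nlinarith)
      rw [this] at h4; linarith
    have h5 : (y j + 1) / b ≤ y j / b + 1 := by
      have := Int.add_mul_ediv_right (y j) 1 hbz.ne'
      have h4 : (y j + 1) / b ≤ (y j + 1 * b) / b := Int.ediv_le_ediv hbz (by nlinarith)
      rw [this] at h4; linarith
    omega

end Blocks

/-! ### The probability that a `★`-connected set of blocks is all bad -/

section AllBad

variable {N b : ℕ}

variable (N b) in
/-- The indicator that all blocks of `W` are bad. [cite: FriedliVelenik2017, §10.4.2] -/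
def allBadInd (W : Finset (Site d)) (σ : SpinConfig (TorusSite d (N * b))) : ℝ :=
  open Classical in if ∀ t ∈ W, BadBlock N b t σ then 1 else 0

/-- `allBadInd` is nonnegative. [folklore] -/
theorem allBadInd_nonneg (W : Finset (Site d)) (σ : SpinConfig (TorusSite d (N * b))) : 0 ≤ allBadInd N b W σ := by
  unfold allBadInd; split_ifs <;> norm_num

/-- `allBadInd` is at most one. [folklore] -/
theorem allBadInd_le_one (W : Finset (Site d)) (σ : SpinConfig (TorusSite d (N * b))) : allBadInd N b W σ ≤ 1 := by
  unfold allBadInd; split_ifs <;> norm_num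

/-- `allBadInd` is antitone in the set of blocks. [folklore] -/
theorem allBadInd_mono {W W' : Finset (Site d)} (h : W ⊆ W') (σ : SpinConfig (TorusSite d (N * b))) :
    allBadInd N b W' σ ≤ allBadInd N b W σ := by
  unfold allBadInd
  split_ifs with h1 h2
  · exact le_rfl
  · exact absurd (fun t ht => h1 t (h ht)) h2
  · norm_num
  · exact le_rfl

variable (d b) in
/-- **The per-block constant** `ε_blk = 2^d · 2^{b^d} · e^{-β/4^d}` of the chessboard–Peierls argument.
[cite: FriedliVelenik2017, §10.4.2] -/
def epsBlk (β : ℝ) : ℝ := 2 ^ d * (2 ^ (b ^ d) * Real.exp (-β / 4 ^ d))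

/-- `ε_blk ≥ 0`. [folklore] -/
theorem epsBlk_nonneg (β : ℝ) : 0 ≤ epsBlk d b β := by unfold epsBlk; positivity

/-- The number of cells of a block is `2^d`. [folklore] -/
theorem card_cellsOf (t : Site d) : #(cellsOf t) = 2 ^ d := by
  rw [cellsOf, Pi.card_Icc]
  simp only [Pi.sub_apply, Pi.one_apply, Int.card_Icc]
  rw [Finset.prod_congr rfl fun i _ => show (t i + 1 - (t i - 1)).toNat = 2 by omega, Finset.prod_const,
    Finset.card_univ, Fintype.card_fin]

/-- The blocks containing a given cell are the `2^d` blocks `t ∈ [c, c+1]`. [folklore] -/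
theorem mem_cellsOf_iff_mem_Icc {t c : Site d} : c ∈ cellsOf t ↔ t ∈ Finset.Icc c (c + 1) := by
  rw [mem_cellsOf, Finset.mem_Icc, Pi.le_def, Pi.le_def]
  simp only [Pi.add_apply, Pi.one_apply]
  constructor
  · intro h; exact ⟨fun i => (h i).2, fun i => by have := (h i).1; omega⟩
  · rintro ⟨h1, h2⟩ i; exact ⟨by have := h2 i; omega, h1 i⟩

/-- The cell-level constant dominates: `2^{b^d} e^{-β/2^d} ≤ (2^{b^d} e^{-β/4^d})^{2^d}`. [folklore] -/
theorem epsCell_le_pow (β : ℝ) :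
    (2 : ℝ) ^ (b ^ d) * Real.exp (-β / 2 ^ d) ≤ ((2 : ℝ) ^ (b ^ d) * Real.exp (-β / 4 ^ d)) ^ (2 ^ d) := by
  rw [mul_pow, ← Real.exp_nat_mul]
  have h4 : (4 : ℝ) ^ d = 2 ^ d * 2 ^ d := by rw [← mul_pow]; norm_num
  have hexp : ((2 ^ d : ℕ) : ℝ) * (-β / 4 ^ d) = -β / 2 ^ d := by
    rw [h4]; push_cast; field_simp
  rw [hexp]
  refine mul_le_mul_of_nonneg_right ?_ (Real.exp_pos _).le
  calc (2 : ℝ) ^ (b ^ d) = ((2 : ℝ) ^ (b ^ d)) ^ 1 := (pow_one _).symm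
    _ ≤ ((2 : ℝ) ^ (b ^ d)) ^ (2 ^ d) := pow_le_pow_right₀ (one_le_pow₀ (by norm_num)) Nat.one_le_two_pow

variable [NeZero N] [NeZero (N * b)]

/-- **The probability that all blocks of a small `★`-connected set `W` are bad is at most `ε_blk^{#W}`**
(`N = 2^(n+1)`, `d ≥ 2`, `b ≥ 2`, `β ≥ 0` with `2^{b^d} e^{-β/4^d} ≤ 1`, `#W ≤ N - 2`): choose a bad cell in
each block; distinct chosen cells are at sup-distance `≤ N - 2`, hence pairwise incongruent mod `N`, so the
chessboard estimate applies to them; a cell is chosen by at most `2^d` blocks, and there are `(2^d)^{#W}`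
choices. [cite: FriedliVelenik2017, §10.4.2 and Theorem 10.11] -/
theorem tExpect_allBadInd_le_pow {n : ℕ} (hd : 2 ≤ d) (hNn : N = 2 ^ (n + 1)) (hb : 2 ≤ b) (p : ℤˣ) {β : ℝ}
    (hβ : 0 ≤ β) (hρ : (2 : ℝ) ^ (b ^ d) * Real.exp (-β / 4 ^ d) ≤ 1)
    {W : Finset (Site d)} (hW : StarConn (W : Set (Site d))) (hWN : #W + 2 ≤ N) :
    tExpect N b p β (allBadInd N b W) ≤ epsBlk d b β ^ #W := by
  classical
  set ρ : ℝ := (2 : ℝ) ^ (b ^ d) * Real.exp (-β / 4 ^ d) with hρdef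
  have hρ0 : 0 ≤ ρ := by positivity
  -- cell choices
  set Fcs : Finset (↥W → Site d) := Fintype.piFinset fun t : ↥W => cellsOf (t : Site d) with hFcs
  have hFcs_card : #Fcs = (2 ^ d) ^ #W := by
    rw [hFcs, Fintype.card_piFinset]
    simp only [card_cellsOf, prod_const, card_univ, Fintype.card_coe]
  -- pointwise union bound over the cell choices
  have hpt : ∀ σ : SpinConfig (TorusSite d (N * b)),
      allBadInd N b W σ ≤ ∑ f ∈ Fcs, ∏ c ∈ (univ : Finset ↥W).image f, badInd N b c σ := by
    intro σ
    unfold allBadInd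
    split_ifs with hall
    · choose g hg using fun t : ↥W => hall t t.2
      have hgF : g ∈ Fcs := Fintype.mem_piFinset.2 fun t => (hg t).1
      refine le_trans ?_ (single_le_sum (f := fun f => ∏ c ∈ (univ : Finset ↥W).image f, badInd N b c σ)
        (fun f _ => prod_nonneg fun c _ => badInd_nonneg c σ) hgF)
      rw [prod_eq_one fun c hc => ?_]
      obtain ⟨t, -, rfl⟩ := mem_image.1 hc
      rw [badInd, if_pos (hg t).2]
    · exact sum_nonneg fun f _ => prod_nonneg fun c _ => badInd_nonneg c σ
  -- each term: chessboard estimate for the chosen cells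
  have hterm : ∀ f ∈ Fcs, tExpect N b p β (fun σ => ∏ c ∈ (univ : Finset ↥W).image f, badInd N b c σ) ≤ ρ ^ #W := by
    intro f hf
    have hfcell : ∀ t : ↥W, f t ∈ cellsOf (t : Site d) := fun t => Fintype.mem_piFinset.1 hf t
    -- the chosen cells are pairwise incongruent mod `N`
    have hinj : Set.InjOn (fun c : Site d => fun j => (c j : ZMod N)) ↑((univ : Finset ↥W).image f) := by
      intro c hc c' hc' hcc
      obtain ⟨t, -, rfl⟩ := mem_image.1 hc
      obtain ⟨t', -, rfl⟩ := mem_image.1 hc'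
      funext i
      have h1 := congrFun hcc i
      simp only at h1
      rw [ZMod.intCast_eq_intCast_iff_dvd_sub] at h1
      have hdist := supDist_lt_card_of_starConn hW t.2 t'.2
      have hi := natAbs_sub_le_supDist (t : Site d) (t' : Site d) i
      have hct := (mem_cellsOf.1 (hfcell t)) i
      have hct' := (mem_cellsOf.1 (hfcell t')) i
      have habs : |f t' i - f t i| < N := by
        rw [abs_lt]; constructor <;> omega
      have := Int.eq_zero_of_abs_lt_dvd h1 habs
      linarith
    have hcb := tExpect_prod_badInd_le_eps_pow hd hNn hb p hβ ((univ : Finset ↥W).image f) hinj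
    refine hcb.trans ?_
    -- `ε_cell^{#C} ≤ ρ^{2^d #C} ≤ ρ^{#W}`
    have hC : #W ≤ 2 ^ d * #((univ : Finset ↥W).image f) := by
      have h := card_eq_sum_card_fiberwise (s := (univ : Finset ↥W)) (t := (univ : Finset ↥W).image f) (f := f)
        fun t _ => mem_image_of_mem f (mem_univ t)
      rw [card_univ, Fintype.card_coe] at h
      rw [h, mul_comm]
      refine le_trans (sum_le_sum (g := fun _ => 2 ^ d) fun c hc => ?_) (by rw [sum_const, smul_eq_mul])
      -- the fibre over `c` injects into the blocks containing the cell `c`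
      calc #((univ : Finset ↥W).filter fun t => f t = c)
          ≤ #(Finset.Icc c (c + 1)) := by
            refine card_le_card_of_injOn (fun t => (t : Site d)) (fun t ht => ?_) (fun t _ t' _ h => Subtype.ext h)
            rw [mem_coe, mem_filter] at ht
            rw [mem_coe, ← mem_cellsOf_iff_mem_Icc, ← ht.2]
            exact hfcell t
        _ = 2 ^ d := by
            rw [Pi.card_Icc]
            simp only [Pi.add_apply, Pi.one_apply, Int.card_Icc]
            rw [Finset.prod_congr rfl fun i _ => show (c i + 1 + 1 - c i).toNat = 2 by omega, Finset.prod_const,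
              Finset.card_univ, Fintype.card_fin]
    calc ((2 : ℝ) ^ (b ^ d) * Real.exp (-β / 2 ^ d)) ^ #((univ : Finset ↥W).image f)
        ≤ (ρ ^ (2 ^ d)) ^ #((univ : Finset ↥W).image f) :=
          pow_le_pow_left₀ (by positivity) (epsCell_le_pow β) _
      _ = ρ ^ (2 ^ d * #((univ : Finset ↥W).image f)) := by rw [pow_mul]
      _ ≤ ρ ^ #W := pow_le_pow_of_le_one hρ0 hρ hC
  -- sum up
  calc tExpect N b p β (allBadInd N b W)
      ≤ tExpect N b p β (fun σ => ∑ f ∈ Fcs, ∏ c ∈ (univ : Finset ↥W).image f, badInd N b c σ) :=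
        tExpect_mono hb p β hpt
    _ = ∑ f ∈ Fcs, tExpect N b p β (fun σ => ∏ c ∈ (univ : Finset ↥W).image f, badInd N b c σ) :=
        tExpect_finset_sum hb p β Fcs _
    _ ≤ ∑ _f ∈ Fcs, ρ ^ #W := sum_le_sum hterm
    _ = (2 ^ d) ^ #W * ρ ^ #W := by rw [sum_const, hFcs_card, nsmul_eq_mul]; push_cast; ring
    _ = (2 ^ d) ^ #W * ((2 : ℝ) ^ (b ^ d) * Real.exp (-β / 4 ^ d)) ^ #W := by rw [hρdef]
    _ = epsBlk d b β ^ #W := by simp only [epsBlk, mul_pow]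

/-- **A single block is bad with probability at most `ε_blk`.** [cite: FriedliVelenik2017, §10.4.2] -/
theorem tExpect_badBlock_le {n : ℕ} (hd : 2 ≤ d) (hNn : N = 2 ^ (n + 1)) (hN3 : 3 ≤ N) (hb : 2 ≤ b) (p : ℤˣ) {β : ℝ}
    (hβ : 0 ≤ β) (hρ : (2 : ℝ) ^ (b ^ d) * Real.exp (-β / 4 ^ d) ≤ 1) (t : Site d) :
    tExpect N b p β (allBadInd N b {t}) ≤ epsBlk d b β := by
  have h := tExpect_allBadInd_le_pow hd hNn hb p hβ hρ (W := {t})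
    (fun x hx y hy => by
      rw [coe_singleton, Set.mem_singleton_iff] at hx hy
      subst hx; subst hy; exact ReflTransGen.refl)
    (by rw [card_singleton]; omega)
  rwa [card_singleton, pow_one] at h

end AllBad

/-! ### Symmetries of the pinned torus measure -/

section Symmetry

variable {N b : ℕ}

variable (N b) in
/-- The shift of the torus by `b e₁` (one period of the image lattice). [folklore] -/
def tShiftVec (i : Fin d) : TorusSite d (N * b) := Pi.single i (b : ZMod (N * b))

variable (N b) in
/-- **The flip–shift symmetry** `σ ↦ -σ(· - b eᵢ)` of the internal-spin system with alternating frozen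
image spins (the global spin flip followed by a shift by one period of the image lattice maps the
pattern `p·ω'_alt` to itself). [cite: VanenterFernandezSokal1993, §4.3.2 (the two ground states ω⁺, ω⁻)] -/
def tFlipShift (i : Fin d) : SpinConfig (TorusSite d (N * b)) ≃ SpinConfig (TorusSite d (N * b)) where
  toFun σ := fun x => -σ (x - tShiftVec N b i)
  invFun σ := fun x => -σ (x + tShiftVec N b i)
  left_inv σ := by funext x; simp
  right_inv σ := by funext x; simp

/-- Pointwise formula for `tFlipShift`. [folklore] -/
@[simp] theorem tFlipShift_apply (i : Fin d) (σ : SpinConfig (TorusSite d (N * b))) (x : TorusSite d (N * b)) :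
    tFlipShift N b i σ x = -σ (x - tShiftVec N b i) := rfl

/-- Shifting an image point by one period of the image lattice. [folklore] -/
theorem tImg_sub_tShiftVec (y : Site d) (i : Fin d) : tImg N b y - tShiftVec N b i = tImg N b (y - Pi.single i 1) := by
  funext j
  by_cases hj : j = i
  · subst hj; simp [tImg, Torus.proj, tShiftVec]; ring
  · simp [tImg, Torus.proj, tShiftVec, hj]

/-- Image sites are shifted to image sites by one period of the image lattice. [folklore] -/
theorem tImg_iff_tImg_sub_tShiftVec (x : TorusSite d (N * b)) (i : Fin d) :
    TImg N b x ↔ TImg N b (x - tShiftVec N b i) := by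
  constructor
  · rintro ⟨y, rfl⟩; exact ⟨y - Pi.single i 1, tImg_sub_tShiftVec y i⟩
  · rintro ⟨y, hy⟩
    refine ⟨y + Pi.single i 1, ?_⟩
    have h := tImg_sub_tShiftVec (N := N) (b := b) (y + Pi.single i 1) i
    rw [add_sub_cancel_right, ← hy] at h
    -- `tImg (y + eᵢ) - s = x - s`
    exact (sub_left_injective h).symm

variable [NeZero (N * b)]

/-- **Re-indexing the Boltzmann sum by a symmetry**: a bijection of configurations preserving the
pinned configurations and the energy preserves Boltzmann sums. [cite: FriedliVelenik2017, §3.1] -/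
theorem tBsum_comp_equiv (p : ℤˣ) (β : ℝ) (Φ : SpinConfig (TorusSite d (N * b)) ≃ SpinConfig (TorusSite d (N * b)))
    (hΩ : ∀ σ, Φ σ ∈ tOmega N b p ↔ σ ∈ tOmega N b p)
    (hH : ∀ σ ∈ tOmega N b p, isingHamiltonian (torusGraph d (N * b)) univ 0 .free (Φ σ) =
      isingHamiltonian (torusGraph d (N * b)) univ 0 .free σ)
    (F : SpinConfig (TorusSite d (N * b)) → ℝ) :
    tBsum N b p β (fun σ => F (Φ σ)) = tBsum N b p β F := by
  unfold tBsum
  refine sum_equiv Φ (fun σ => (hΩ σ).symm) fun σ hσ => ?_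
  rw [hH σ hσ]

/-- The corresponding statement for expectations. [cite: FriedliVelenik2017, §3.1] -/
theorem tExpect_comp_equiv (hb : 2 ≤ b) (p : ℤˣ) (β : ℝ)
    (Φ : SpinConfig (TorusSite d (N * b)) ≃ SpinConfig (TorusSite d (N * b)))
    (hΩ : ∀ σ, Φ σ ∈ tOmega N b p ↔ σ ∈ tOmega N b p)
    (hH : ∀ σ ∈ tOmega N b p, isingHamiltonian (torusGraph d (N * b)) univ 0 .free (Φ σ) =
      isingHamiltonian (torusGraph d (N * b)) univ 0 .free σ)
    (F : SpinConfig (TorusSite d (N * b)) → ℝ) :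
    tExpect N b p β (fun σ => F (Φ σ)) = tExpect N b p β F := by
  rw [tExpect_eq_tBsum_div hb, tExpect_eq_tBsum_div hb, tBsum_comp_equiv p β Φ hΩ hH]

/-- **Invariance under the reflections through image hyperplanes.** [cite: FriedliVelenik2017, §10.3] -/
theorem tExpect_comp_tRefl (hN : Even N) (hb : 2 ≤ b) (p : ℤˣ) (β : ℝ) (i : Fin d) (k : ℤ)
    (F : SpinConfig (TorusSite d (N * b)) → ℝ) :
    tExpect N b p β (fun σ => F (σ ∘ tRefl N b i k)) = tExpect N b p β F := by
  have hb0 : 0 < b := by omega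
  set θ := tRefl N b i k with hθ
  have hθinv : Function.Involutive θ := Torus.reflectThroughSites_involutive i _
  have hadj : ∀ x y, (torusGraph d (N * b)).Adj (θ x) (θ y) ↔ (torusGraph d (N * b)).Adj x y := by
    intro x y
    constructor
    · intro h
      have := Torus.torusGraph_adj_reflectThroughSites i (((b : ℤ) * k : ℤ) : ZMod (N * b)) h
      rwa [show Torus.reflectThroughSites i _ (θ x) = x from hθinv x,
        show Torus.reflectThroughSites i _ (θ y) = y from hθinv y] at this
    · exact fun h => Torus.torusGraph_adj_reflectThroughSites i _ h
  let Φ : SpinConfig (TorusSite d (N * b)) ≃ SpinConfig (TorusSite d (N * b)) := configReflect θ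
  have hΦ : ∀ σ, (Φ σ : SpinConfig (TorusSite d (N * b))) = σ ∘ θ := fun σ => rfl
  have hpin : ∀ x, ¬ x ∈ tFree N b → torusPin N b p (θ x) = torusPin N b p x := by
    intro x hx
    rw [mem_tFree, not_not] at hx
    obtain ⟨y, rfl⟩ := hx
    exact torusPin_reflect hN hb0 p i k y
  have hfree : ∀ x, x ∈ tFree N b ↔ θ x ∈ tFree N b := fun x => by rw [mem_tFree, mem_tFree, hθ, tImg_reflect_iff]
  have hΩ : ∀ σ, Φ σ ∈ tOmega N b p ↔ σ ∈ tOmega N b p := by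
    intro σ
    rw [mem_tOmega, mem_tOmega, hΦ]
    constructor
    · intro h x hx
      have hθx : θ x ∉ tFree N b := fun h' => hx (by rwa [hfree, hθinv x] at h')
      have := h (θ x) hθx
      rw [Function.comp_apply, hθinv x] at this
      rw [this, hpin x hx]
    · intro h x hx
      have hθx : θ x ∉ tFree N b := fun h' => hx ((hfree x).2 h')
      rw [Function.comp_apply, h (θ x) hθx, hpin x hx]
  have hH : ∀ σ ∈ tOmega N b p, isingHamiltonian (torusGraph d (N * b)) univ 0 .free (Φ σ) =
      isingHamiltonian (torusGraph d (N * b)) univ 0 .free σ :=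
    fun σ _ => isingHamiltonian_univ_free_comp_equiv (torusGraph d (N * b)) θ hadj 0 σ
  exact tExpect_comp_equiv hb p β Φ hΩ hH F

/-- The nearest-neighbour Hamiltonian at zero field is even. [cite: FriedliVelenik2017, §3.7.1] -/
theorem isingHamiltonian_univ_free_neg {V : Type*} [Fintype V] [DecidableEq V] (G : SimpleGraph V) [G.LocallyFinite]
    (σ : SpinConfig V) : isingHamiltonian G univ 0 .free (-σ) = isingHamiltonian G univ 0 .free σ := by
  simp only [isingHamiltonian, zero_mul, sub_zero, neg_inj]
  refine sum_congr rfl fun e _ => ?_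
  induction e using Sym2.ind with
  | _ x y => simp [bondSpin_mk, spinAt, Units.val_neg]

/-- **Invariance of the pinned torus measure under the flip–shift symmetry.**
[cite: VanenterFernandezSokal1993, §4.3.2] -/
theorem tExpect_flipShift (hN : Even N) (hb : 2 ≤ b) (p : ℤˣ) (β : ℝ) (i : Fin d)
    (F : SpinConfig (TorusSite d (N * b)) → ℝ) :
    tExpect N b p β (fun σ => F (tFlipShift N b i σ)) = tExpect N b p β F := by
  have hb0 : 0 < b := by omega
  set s := tShiftVec N b i with hs
  have hfree : ∀ x, x ∉ tFree N b ↔ x - s ∉ tFree N b := fun x => by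
    rw [mem_tFree, mem_tFree, not_not, not_not]; exact tImg_iff_tImg_sub_tShiftVec x i
  have hpin : ∀ x, x ∉ tFree N b → torusPin N b p (x - s) = -torusPin N b p x := by
    intro x hx
    rw [mem_tFree, not_not] at hx
    obtain ⟨y, rfl⟩ := hx
    rw [hs, tImg_sub_tShiftVec]
    have h := torusPin_tImg_add_single hN hb0 p (y - Pi.single i 1) i
    rw [sub_add_cancel] at h
    rw [h, neg_neg]
  have hΩ : ∀ σ, tFlipShift N b i σ ∈ tOmega N b p ↔ σ ∈ tOmega N b p := by
    intro σ
    rw [mem_tOmega, mem_tOmega]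
    constructor
    · intro h x hx
      have hx' : x + s ∉ tFree N b := by rw [hfree, add_sub_cancel_right]; exact hx
      have h1 := h (x + s) hx'
      rw [tFlipShift_apply, ← hs, add_sub_cancel_right] at h1
      have h2 := hpin (x + s) hx'
      rw [add_sub_cancel_right] at h2
      -- `-σ x = pin (x + s) = -pin x`
      have h3 : torusPin N b p (x + s) = -torusPin N b p x := by rw [← neg_neg (torusPin N b p (x + s)), ← h2]
      rw [h3] at h1
      exact neg_injective h1
    · intro h x hx
      have hx' : x - s ∉ tFree N b := (hfree x).1 hx
      rw [tFlipShift_apply, ← hs, h _ hx', hpin x hx, neg_neg]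
  have hH : ∀ σ ∈ tOmega N b p, isingHamiltonian (torusGraph d (N * b)) univ 0 .free (tFlipShift N b i σ) =
      isingHamiltonian (torusGraph d (N * b)) univ 0 .free σ := by
    intro σ _
    have h1 : (tFlipShift N b i σ : SpinConfig (TorusSite d (N * b))) = -(σ ∘ Equiv.subRight s) := by
      funext x; simp [hs]
    rw [h1, isingHamiltonian_univ_free_neg]
    exact isingHamiltonian_univ_free_comp_equiv (torusGraph d (N * b)) (Equiv.subRight s)
      (fun x y => by simpa [sub_eq_add_neg] using torusGraph_adj_add_right (-s) x y) 0 σ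
  exact tExpect_comp_equiv hb p β (tFlipShift N b i) hΩ hH F

end Symmetry

/-! ### Transformation of blocks under the symmetries; plus cubes are likely -/

section PlusCube

variable {N b : ℕ}

variable (N b) in
/-- **Minus blocks**: not bad, and the marked internal site carries `-1`. [cite: FriedliVelenik2017, §10.4.2] -/
def MinusBlock (hd : 0 < d) (t : Site d) (σ : SpinConfig (TorusSite d (N * b))) : Prop :=
  ¬ BadBlock N b t σ ∧ σ (Torus.proj (N * b) (blockSite b hd t)) = -1

/-- The reflection of `ℤ^d` through `yᵢ = bk` maps internal cell sites to internal cell sites of the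
reflected cell. [folklore] -/
theorem reflZ_mem_freeCellZ (i : Fin d) (k : ℤ) {c y : Site d} (hy : y ∈ freeCellZ b c) :
    Function.update y i (2 * b * k - y i) ∈ freeCellZ b (Function.update c i (2 * k - 1 - c i)) := by
  rw [mem_freeCellZ] at hy ⊢
  refine ⟨mem_cellZ.2 fun j => ?_, fun h => hy.2 fun j => ?_⟩
  · by_cases hj : j = i
    · subst hj
      simp only [Function.update_self]
      have := (mem_cellZ.1 hy.1) j
      constructor <;> nlinarith
    · simp only [Function.update_of_ne hj]
      exact (mem_cellZ.1 hy.1) j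
  · by_cases hj : j = i
    · subst hj
      have := h j
      simp only [Function.update_self] at this
      have h2 : (b : ℤ) ∣ 2 * b * k := ⟨2 * k, by ring⟩
      simpa using dvd_sub h2 this
    · have := h j
      simp only [Function.update_of_ne hj] at this
      exact this

/-- **Bad blocks under the reflection through image hyperplanes**: the centred block reflection
`t ↦ t[i ↦ 2k - tᵢ]`. [cite: FriedliVelenik2017, §10.2] -/
theorem badBlock_comp_tRefl [NeZero (N * b)] (i : Fin d) (k : ℤ) (t : Site d) (σ : SpinConfig (TorusSite d (N * b))) :
    BadBlock N b t (σ ∘ tRefl N b i k) ↔ BadBlock N b (Function.update t i (2 * k - t i)) σ := by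
  constructor
  · rintro ⟨c, hc, hbad⟩
    refine ⟨Function.update c i (2 * k - 1 - c i), mem_cellsOf.2 fun j => ?_, (badCell_comp_tRefl i k c σ).1 hbad⟩
    have := (mem_cellsOf.1 hc) j
    by_cases hj : j = i
    · subst hj; simp only [Function.update_self]; omega
    · simp only [Function.update_of_ne hj]; exact this
  · rintro ⟨c', hc', hbad⟩
    refine ⟨Function.update c' i (2 * k - 1 - c' i), mem_cellsOf.2 fun j => ?_, ?_⟩
    · have := (mem_cellsOf.1 hc') j
      by_cases hj : j = i
      · subst hj; simp only [Function.update_self] at this ⊢; omega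
      · simp only [Function.update_of_ne hj] at this ⊢; exact this
    · rw [badCell_comp_tRefl]
      have : Function.update (Function.update c' i (2 * k - 1 - c' i)) i
          (2 * k - 1 - Function.update c' i (2 * k - 1 - c' i) i) = c' := by
        ext j; by_cases hj : j = i
        · subst hj; simp
        · simp [hj]
      rw [this]; exact hbad

/-- **Plus blocks under the reflection through image hyperplanes** (`d ≥ 2`, `b ≥ 2`).
[cite: FriedliVelenik2017, §10.2] -/
theorem plusBlock_comp_tRefl [NeZero (N * b)] (hd : 2 ≤ d) (hb : 2 ≤ b) (i : Fin d) (k : ℤ) (t : Site d)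
    (σ : SpinConfig (TorusSite d (N * b))) :
    PlusBlock N b (by omega) t (σ ∘ tRefl N b i k) ↔ PlusBlock N b (by omega) (Function.update t i (2 * k - t i)) σ := by
  set t' := Function.update t i (2 * k - t i) with ht'
  -- the reflected marked site is an internal site of a cell of the reflected block
  have hcell : Function.update t i (2 * k - 1 - t i) ∈ cellsOf t' := mem_cellsOf.2 fun j => by
    by_cases hj : j = i
    · subst hj; simp only [ht', Function.update_self]; omega
    · simp only [ht', Function.update_of_ne hj]; exact ⟨by omega, le_rfl⟩
  have hmark : Function.update (blockSite b (by omega) t) i (2 * b * k - blockSite b (by omega) t i) ∈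
      freeCellZ b (Function.update t i (2 * k - 1 - t i)) :=
    reflZ_mem_freeCellZ i k (blockSite_mem_freeCellZ hb (by omega) t)
  have hval : ∀ {τ : SpinConfig (TorusSite d (N * b))}, ¬ BadBlock N b t' τ →
      τ (tRefl N b i k (Torus.proj (N * b) (blockSite b (by omega) t))) = τ (Torus.proj (N * b) (blockSite b (by omega) t')) := by
    intro τ hgood
    rw [tRefl_proj]
    have hgood' : ∀ c ∈ cellsOf t', ¬ BadCell N b c τ := fun c hc hbad => hgood ⟨c, hc, hbad⟩
    exact apply_eq_of_forall_not_badCell hd hb hgood' hcell hmark (blockSite_mem_freeCellZ hb (by omega) t')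
  unfold PlusBlock
  rw [badBlock_comp_tRefl]
  constructor
  · rintro ⟨hgood, h1⟩
    exact ⟨hgood, by rw [← hval hgood]; exact h1⟩
  · rintro ⟨hgood, h1⟩
    refine ⟨hgood, ?_⟩
    show σ (tRefl N b i k (Torus.proj (N * b) (blockSite b (by omega) t))) = 1
    rw [hval hgood, h1]

/-- Badness is invariant under the global spin flip. [folklore] -/
theorem badCell_neg (c : Site d) (σ : SpinConfig (TorusSite d (N * b))) : BadCell N b c (-σ) ↔ BadCell N b c σ := by
  unfold BadCell
  simp only [Pi.neg_apply, ne_eq, neg_inj]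

/-- Subtracting the shift vector from a projected point. [folklore] -/
theorem proj_sub_tShiftVec (y : Site d) (i : Fin d) :
    Torus.proj (N * b) y - tShiftVec N b i = Torus.proj (N * b) (y - fun j => (b : ℤ) * (Pi.single i (1 : ℤ) : Site d) j) := by
  funext j
  by_cases hj : j = i
  · subst hj; simp [Torus.proj, tShiftVec]
  · simp [Torus.proj, tShiftVec, hj]

/-- **Bad blocks under the flip–shift symmetry**: the block shift `t ↦ t - eᵢ`.
[cite: VanenterFernandezSokal1993, §4.3.2] -/
theorem badBlock_flipShift [NeZero (N * b)] (i : Fin d) (t : Site d) (σ : SpinConfig (TorusSite d (N * b))) :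
    BadBlock N b t (tFlipShift N b i σ) ↔ BadBlock N b (t - Pi.single i 1) σ := by
  have hcell : ∀ c : Site d, BadCell N b c (tFlipShift N b i σ) ↔ BadCell N b (c - Pi.single i 1) σ := by
    intro c
    have h1 : (tFlipShift N b i σ : SpinConfig (TorusSite d (N * b))) = -fun x => σ (x - tShiftVec N b i) := by
      funext x; simp
    rw [h1, badCell_neg]
    refine badCell_iff_of_maps (fun y => y + fun j => (b : ℤ) * (-(Pi.single i (1 : ℤ) : Site d)) j) (fun y hy => ?_)
      (fun y' hy' => ?_) (fun y _ => ?_)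
    · have := add_mem_freeCellZ (-(Pi.single i (1 : ℤ) : Site d)) hy
      rwa [← sub_eq_add_neg] at this
    · refine ⟨y' + fun j => (b : ℤ) * (Pi.single i (1 : ℤ) : Site d) j, ?_, ?_⟩
      · have := add_mem_freeCellZ (Pi.single i (1 : ℤ) : Site d) hy'
        rwa [sub_add_cancel] at this
      · funext j; simp only [Pi.add_apply, Pi.neg_apply]; ring
    · show σ (Torus.proj (N * b) y - tShiftVec N b i) =
        σ (Torus.proj (N * b) (y + fun j => (b : ℤ) * (-(Pi.single i (1 : ℤ) : Site d)) j))
      rw [proj_sub_tShiftVec]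
      congr 2
      funext j; simp only [Pi.sub_apply, Pi.add_apply, Pi.neg_apply]; ring
  constructor
  · rintro ⟨c, hc, hbad⟩
    refine ⟨c - Pi.single i 1, mem_cellsOf.2 fun j => ?_, (hcell c).1 hbad⟩
    have := (mem_cellsOf.1 hc) j
    simp only [Pi.sub_apply]
    omega
  · rintro ⟨c, hc, hbad⟩
    refine ⟨c + Pi.single i 1, mem_cellsOf.2 fun j => ?_, ?_⟩
    · have := (mem_cellsOf.1 hc) j
      simp only [Pi.sub_apply] at this
      simp only [Pi.add_apply]
      omega
    · rw [hcell, add_sub_cancel_right]; exact hbad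

/-- The marked site shifts with the block. [folklore] -/
theorem blockSite_sub (hd : 0 < d) (t : Site d) (i : Fin d) :
    (blockSite b hd t - fun j => (b : ℤ) * (Pi.single i (1 : ℤ) : Site d) j) = blockSite b hd (t - Pi.single i 1) := by
  funext j
  simp only [blockSite, Pi.sub_apply]
  ring

/-- **Plus blocks under the flip–shift symmetry become minus blocks.**
[cite: VanenterFernandezSokal1993, §4.3.2] -/
theorem plusBlock_flipShift [NeZero (N * b)] (hd : 0 < d) (i : Fin d) (t : Site d) (σ : SpinConfig (TorusSite d (N * b))) :
    PlusBlock N b hd t (tFlipShift N b i σ) ↔ MinusBlock N b hd (t - Pi.single i 1) σ := by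
  unfold PlusBlock MinusBlock
  rw [badBlock_flipShift, tFlipShift_apply, proj_sub_tShiftVec, blockSite_sub]
  refine and_congr_right fun _ => ?_
  constructor
  · intro h; have := congrArg Neg.neg h; rw [neg_neg] at this; rw [this]
  · intro h; rw [h, neg_neg]

/-- **Markers of `★`-adjacent good blocks agree** (they share a cell). [cite: FriedliVelenik2017, §10.4.2] -/
theorem marker_eq_of_adj (hd : 2 ≤ d) (hb : 2 ≤ b) {t t' : Site d} {σ : SpinConfig (TorusSite d (N * b))}
    (hadj : (zdStar d).Adj t t') (ht : ¬ BadBlock N b t σ) (ht' : ¬ BadBlock N b t' σ) :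
    σ (Torus.proj (N * b) (blockSite b (by omega) t)) = σ (Torus.proj (N * b) (blockSite b (by omega) t')) := by
  obtain ⟨c, hc, hc'⟩ := exists_mem_cellsOf_inter hadj
  obtain ⟨y, hy, -⟩ := exists_mem_freeCellZ_inter hd hb c ⟨0, by omega⟩
  have hg : ∀ c ∈ cellsOf t, ¬ BadCell N b c σ := fun c hc hbad => ht ⟨c, hc, hbad⟩
  have hg' : ∀ c ∈ cellsOf t', ¬ BadCell N b c σ := fun c hc hbad => ht' ⟨c, hc, hbad⟩
  rw [← apply_eq_of_forall_not_badCell hd hb hg hc hy (blockSite_mem_freeCellZ hb (by omega) t),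
    apply_eq_of_forall_not_badCell hd hb hg' hc' hy (blockSite_mem_freeCellZ hb (by omega) t')]

/-- **A `★`-connected set of good blocks is uniformly plus or uniformly minus.**
[cite: FriedliVelenik2017, §10.4.2] -/
theorem forall_plusBlock_or_forall_minusBlock (hd : 2 ≤ d) (hb : 2 ≤ b) {D : Finset (Site d)}
    (hD : StarConn (D : Set (Site d))) {σ : SpinConfig (TorusSite d (N * b))} (hgood : ∀ t ∈ D, ¬ BadBlock N b t σ) :
    (∀ t ∈ D, PlusBlock N b (by omega) t σ) ∨ (∀ t ∈ D, MinusBlock N b (by omega) t σ) := by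
  rcases D.eq_empty_or_nonempty with rfl | ⟨t₀, ht₀⟩
  · left; simp
  have hconst : ∀ t ∈ D, σ (Torus.proj (N * b) (blockSite b (by omega) t)) = σ (Torus.proj (N * b) (blockSite b (by omega) t₀)) := by
    intro t ht
    have h := hD t₀ (mem_coe.2 ht₀) t (mem_coe.2 ht)
    clear ht
    induction h with
    | refl => rfl
    | @tail u v _ huv ih => rw [← marker_eq_of_adj hd hb huv.1 (hgood u huv.2.1) (hgood v huv.2.2), ih]
  rcases Int.units_eq_one_or (σ (Torus.proj (N * b) (blockSite b (by omega) t₀))) with h1 | h1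
  · left; exact fun t ht => ⟨hgood t ht, (hconst t ht).trans h1⟩
  · right; exact fun t ht => ⟨hgood t ht, (hconst t ht).trans h1⟩

variable (N b) in
/-- The indicator that all blocks of `D` are plus. [cite: FriedliVelenik2017, §10.4.2] -/
def plusAllInd (hd : 0 < d) (D : Finset (Site d)) (σ : SpinConfig (TorusSite d (N * b))) : ℝ :=
  open Classical in if ∀ t ∈ D, PlusBlock N b hd t σ then 1 else 0

variable (N b) in
/-- The indicator that all blocks of `D` are minus. [cite: FriedliVelenik2017, §10.4.2] -/
def minusAllInd (hd : 0 < d) (D : Finset (Site d)) (σ : SpinConfig (TorusSite d (N * b))) : ℝ :=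
  open Classical in if ∀ t ∈ D, MinusBlock N b hd t σ then 1 else 0

/-- `plusAllInd` is nonnegative. [folklore] -/
theorem plusAllInd_nonneg (hd : 0 < d) (D : Finset (Site d)) (σ : SpinConfig (TorusSite d (N * b))) :
    0 ≤ plusAllInd N b hd D σ := by
  unfold plusAllInd; split_ifs <;> norm_num

/-- `plusAllInd` only depends on the spins at the internal sites of the cells of the blocks of `D`.
[cite: FriedliVelenik2017, §10.4.2] -/
theorem plusAllInd_congr (hd : 0 < d) {D : Finset (Site d)} {σ σ' : SpinConfig (TorusSite d (N * b))}
    (h : ∀ t ∈ D, ∀ c ∈ cellsOf t, ∀ y ∈ freeCellZ b c, σ (Torus.proj (N * b) y) = σ' (Torus.proj (N * b) y))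
    (hb : 2 ≤ b) : plusAllInd N b hd D σ = plusAllInd N b hd D σ' := by
  have hiff : ∀ t ∈ D, (PlusBlock N b hd t σ ↔ PlusBlock N b hd t σ') := by
    intro t ht
    unfold PlusBlock BadBlock
    rw [h t ht t (self_mem_cellsOf t) _ (blockSite_mem_freeCellZ hb hd t)]
    refine and_congr_left fun _ => not_congr (exists_congr fun c => and_congr_right fun hc => badCell_congr (h t ht c hc))
  unfold plusAllInd
  have : (∀ t ∈ D, PlusBlock N b hd t σ) ↔ ∀ t ∈ D, PlusBlock N b hd t σ' :=
    forall₂_congr fun t ht => hiff t ht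
  by_cases h1 : ∀ t ∈ D, PlusBlock N b hd t σ
  · rw [if_pos h1, if_pos (this.1 h1)]
  · rw [if_neg h1, if_neg (fun h2 => h1 (this.2 h2))]

variable [NeZero N] [NeZero (N * b)]

/-- **Plus cubes are likely** (the symmetry step of the chessboard–Peierls argument): for a
`★`-connected set `D` of blocks and a direction `i` such that the reflection `t ↦ t[i ↦ 2k - tᵢ]`
maps `D` onto `D + 2eᵢ`, `P(all blocks of D plus) ≥ (1 - (#D + #(D + eᵢ)) ε_blk) / 2`: if no block
of `D' = D ∪ (D + eᵢ)` is bad then `D'` is uniformly plus or uniformly minus; `D'` uniformly minus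
makes `D + eᵢ` uniformly minus, which under the flip–shift symmetry is as likely as `D + 2eᵢ`
uniformly plus, i.e. (reflection) as `D` uniformly plus.
[cite: FriedliVelenik2017, §10.4.2] [cite: VanenterFernandezSokal1993, §4.3.2] -/
theorem tExpect_plusAllInd_ge {n : ℕ} (hd : 2 ≤ d) (hNn : N = 2 ^ (n + 1)) (hN3 : 3 ≤ N) (hb : 2 ≤ b) (p : ℤˣ)
    {β : ℝ} (hβ : 0 ≤ β) (hρ : (2 : ℝ) ^ (b ^ d) * Real.exp (-β / 4 ^ d) ≤ 1)
    {D : Finset (Site d)} (i : Fin d) (k : ℤ)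
    (hD' : StarConn ((D ∪ D.image (· + Pi.single i 1) : Finset (Site d)) : Set (Site d)))
    (hrefl : D.image (fun t => Function.update t i (2 * k - t i)) = D.image (· + Pi.single i 1 + Pi.single i 1)) :
    (1 - (#D + #D) * epsBlk d b β) / 2 ≤ tExpect N b p β (plusAllInd N b (by omega) D) := by
  classical
  have hN : Even N := hNn ▸ Nat.even_pow.2 ⟨even_two, Nat.succ_ne_zero n⟩
  have hd0 : 0 < d := by omega
  set e : Site d := Pi.single i 1 with he
  set D1 := D.image (· + e) with hD1
  set D2 := D.image (· + e + e) with hD2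
  set D' := D ∪ D1 with hD'def
  -- pointwise: `1 ≤ 𝟙[bad in D'] + 𝟙[D plus] + 𝟙[D + e minus]`
  have hpt : ∀ σ : SpinConfig (TorusSite d (N * b)),
      (1 : ℝ) ≤ (∑ t ∈ D', allBadInd N b {t} σ) + plusAllInd N b hd0 D σ + minusAllInd N b hd0 D1 σ := by
    intro σ
    by_cases hbad : ∃ t ∈ D', BadBlock N b t σ
    · obtain ⟨t, ht, hbt⟩ := hbad
      have h1 : (1 : ℝ) ≤ ∑ t ∈ D', allBadInd N b {t} σ := by
        refine le_trans ?_ (single_le_sum (fun t _ => allBadInd_nonneg {t} σ) ht)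
        rw [allBadInd, if_pos (by simpa using hbt)]
      have h2 := plusAllInd_nonneg (N := N) (b := b) hd0 D σ
      have h3 : 0 ≤ minusAllInd N b hd0 D1 σ := by unfold minusAllInd; split_ifs <;> norm_num
      linarith
    · push Not at hbad
      have hsum : 0 ≤ ∑ t ∈ D', allBadInd N b {t} σ := sum_nonneg fun t _ => allBadInd_nonneg {t} σ
      rcases forall_plusBlock_or_forall_minusBlock hd hb hD' hbad with hplus | hminus
      · have : plusAllInd N b hd0 D σ = 1 := by
          rw [plusAllInd, if_pos fun t ht => hplus t (mem_union_left _ ht)]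
        have h3 : 0 ≤ minusAllInd N b hd0 D1 σ := by unfold minusAllInd; split_ifs <;> norm_num
        linarith
      · have : minusAllInd N b hd0 D1 σ = 1 := by
          rw [minusAllInd, if_pos fun t ht => hminus t (mem_union_right _ ht)]
        have h2 := plusAllInd_nonneg (N := N) (b := b) hd0 D σ
        linarith
  -- expectations of the three terms
  have hE1 : tExpect N b p β (fun σ => ∑ t ∈ D', allBadInd N b {t} σ) ≤ (#D + #D) * epsBlk d b β := by
    rw [tExpect_finset_sum hb]
    calc ∑ t ∈ D', tExpect N b p β (allBadInd N b {t}) ≤ ∑ _t ∈ D', epsBlk d b β :=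
          sum_le_sum fun t _ => tExpect_badBlock_le hd hNn hN3 hb p hβ hρ t
      _ = #D' * epsBlk d b β := by rw [sum_const, nsmul_eq_mul]
      _ ≤ (#D + #D) * epsBlk d b β := by
          refine mul_le_mul_of_nonneg_right ?_ (epsBlk_nonneg β)
          have : #D' ≤ #D + #D1 := card_union_le _ _
          have h1 : #D1 ≤ #D := card_image_le
          exact_mod_cast this.trans (by omega)
  have hE3 : tExpect N b p β (minusAllInd N b hd0 D1) = tExpect N b p β (plusAllInd N b hd0 D) := by
    -- flip–shift: `D + e` minus ↔ `D + 2e` plus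
    have h1 : (fun σ => plusAllInd N b hd0 D2 (tFlipShift N b i σ)) = minusAllInd N b hd0 D1 := by
      funext σ
      unfold plusAllInd minusAllInd
      have : (∀ t ∈ D2, PlusBlock N b hd0 t (tFlipShift N b i σ)) ↔ ∀ t ∈ D1, MinusBlock N b hd0 t σ := by
        simp only [hD2, hD1, forall_mem_image, plusBlock_flipShift, ← he, add_sub_cancel_right]
      by_cases hc : ∀ t ∈ D2, PlusBlock N b hd0 t (tFlipShift N b i σ)
      · rw [if_pos hc, if_pos (this.1 hc)]
      · rw [if_neg hc, if_neg (fun h2 => hc (this.2 h2))]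
    -- reflection: `D + 2e` plus ↔ `D` plus
    have h2 : (fun σ => plusAllInd N b hd0 D (σ ∘ tRefl N b i k)) = plusAllInd N b hd0 D2 := by
      funext σ
      unfold plusAllInd
      have : (∀ t ∈ D, PlusBlock N b hd0 t (σ ∘ tRefl N b i k)) ↔ ∀ t ∈ D2, PlusBlock N b hd0 t σ := by
        have h3 : (∀ t ∈ D, PlusBlock N b hd0 (Function.update t i (2 * k - t i)) σ) ↔
            ∀ t' ∈ D.image (fun t => Function.update t i (2 * k - t i)), PlusBlock N b hd0 t' σ :=
          (forall_mem_image (p := fun t' => PlusBlock N b hd0 t' σ)).symm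
        simp only [plusBlock_comp_tRefl hd hb]
        rw [h3, hrefl]
      by_cases hc : ∀ t ∈ D, PlusBlock N b hd0 t (σ ∘ tRefl N b i k)
      · rw [if_pos hc, if_pos (this.1 hc)]
      · rw [if_neg hc, if_neg (fun h2 => hc (this.2 h2))]
    rw [← h1, tExpect_flipShift hN hb p β i, ← h2, tExpect_comp_tRefl hN hb p β i k]
  -- assemble
  have hmain := tExpect_mono hb p β hpt
  rw [tExpect_one hb, tExpect_add hb, tExpect_add hb, hE3] at hmain
  linarith

end PlusCube

/-! ### Long `-` paths force long bad contours -/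

section FarEvents

variable {N b : ℕ}

/-- The `-` nearest-neighbour relation of a configuration of `ℤ^d` inside a set `Λ`. [folklore] -/
def minusRel (Λ : Finset (Site d)) (σ : SpinConfig (Site d)) (a c : Site d) : Prop :=
  (zdGraph d).Adj a c ∧ (a ∈ Λ ∧ σ a = -1) ∧ (c ∈ Λ ∧ σ c = -1)

/-- **The far event**: a path of `-` spins of `Λ` joins a neighbour of the origin to a site at
sup-distance `> m` from the origin (for the system of `VEFS1993_plusPhase` with the origin frozen:
a `-` cluster of a neighbour of the origin is not confined to the cube of radius `m`).
[cite: VanenterFernandezSokal1993, §4.1.2 Step 3 and §4.3.1 Step 2] -/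
def FarEvent (Λ : Finset (Site d)) (m : ℕ) (σ : SpinConfig (Site d)) : Prop :=
  ∃ u v : Site d, (zdGraph d).Adj 0 u ∧ u ∈ Λ ∧ σ u = -1 ∧ m < supDist 0 v ∧ ReflTransGen (minusRel Λ σ) u v

/-- The indicator of the far event. [cite: VanenterFernandezSokal1993, §4.1.2 Step 3] -/
def farInd (Λ : Finset (Site d)) (m : ℕ) (σ : SpinConfig (Site d)) : ℝ :=
  open Classical in if FarEvent Λ m σ then 1 else 0

/-- `farInd ≥ 0`. [folklore] -/
theorem farInd_nonneg (Λ : Finset (Site d)) (m : ℕ) (σ : SpinConfig (Site d)) : 0 ≤ farInd Λ m σ := by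
  unfold farInd; split_ifs <;> norm_num

/-- `farInd ≤ 1`. [folklore] -/
theorem farInd_le_one (Λ : Finset (Site d)) (m : ℕ) (σ : SpinConfig (Site d)) : farInd Λ m σ ≤ 1 := by
  unfold farInd; split_ifs <;> norm_num

/-- A unit below a `-1` is `-1`. [folklore] -/
theorem eq_neg_one_of_le {u v : ℤˣ} (huv : u ≤ v) (hv : v = -1) : u = -1 :=
  le_antisymm (hv ▸ huv) (neg_one_le_intUnits u)

/-- `-` chains persist when the `-` spins of `Λ` persist. [folklore] -/
theorem reflTransGen_minusRel_of_imp {Λ : Finset (Site d)} {σ σ' : SpinConfig (Site d)}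
    (h : ∀ x ∈ Λ, σ' x = -1 → σ x = -1) {u v : Site d} (hc : ReflTransGen (minusRel Λ σ') u v) :
    ReflTransGen (minusRel Λ σ) u v := by
  induction hc with
  | refl => exact ReflTransGen.refl
  | tail _ hbc ih =>
    exact ih.tail ⟨hbc.1, ⟨hbc.2.1.1, h _ hbc.2.1.1 hbc.2.1.2⟩, ⟨hbc.2.2.1, h _ hbc.2.2.1 hbc.2.2.2⟩⟩

/-- The far event persists when the `-` spins of `Λ` persist. [folklore] -/
theorem farEvent_of_imp {Λ : Finset (Site d)} {m : ℕ} {σ σ' : SpinConfig (Site d)}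
    (h : ∀ x ∈ Λ, σ' x = -1 → σ x = -1) (hf : FarEvent Λ m σ') : FarEvent Λ m σ := by
  obtain ⟨u, v, hu, huΛ, hσu, hv, hchain⟩ := hf
  exact ⟨u, v, hu, huΛ, h u huΛ hσu, hv, reflTransGen_minusRel_of_imp h hchain⟩

/-- **The far event is decreasing** (lowering spins keeps `-` paths). [folklore] -/
theorem farEvent_anti {Λ : Finset (Site d)} {m : ℕ} {σ σ' : SpinConfig (Site d)} (hle : σ ≤ σ')
    (h : FarEvent Λ m σ') : FarEvent Λ m σ :=
  farEvent_of_imp (fun x _ hx => eq_neg_one_of_le (hle x) hx) h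

/-- `farInd` is antitone. [folklore] -/
theorem farInd_antitone (Λ : Finset (Site d)) (m : ℕ) : Antitone (farInd (d := d) Λ m) := by
  intro σ σ' hle
  show farInd Λ m σ' ≤ farInd Λ m σ
  unfold farInd
  by_cases h1 : FarEvent Λ m σ'
  · rw [if_pos h1, if_pos (farEvent_anti hle h1)]
  · rw [if_neg h1]; split_ifs <;> norm_num

/-- `farInd` only depends on the spins in `Λ`. [folklore] -/
theorem farInd_congr {Λ : Finset (Site d)} (m : ℕ) {σ σ' : SpinConfig (Site d)} (h : ∀ x ∈ Λ, σ x = σ' x) :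
    farInd Λ m σ = farInd Λ m σ' := by
  unfold farInd
  by_cases h1 : FarEvent Λ m σ
  · rw [if_pos h1, if_pos (farEvent_of_imp (fun x hx hσ => by rw [← h x hx]; exact hσ) h1)]
  · rw [if_neg h1, if_neg (fun h2 => h1 (farEvent_of_imp (fun x hx hσ => by rw [h x hx]; exact hσ) h2))]

variable (d) in
/-- The cube of blocks of radius `r` about `y₀`. [cite: FriedliVelenik2017, §10.4.2] -/
def ballBlocks (y₀ : Site d) (r : ℕ) : Finset (Site d) := (box d r).image (· + y₀)

/-- Membership in `ballBlocks`. [folklore] -/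
theorem mem_ballBlocks {y₀ : Site d} {r : ℕ} {t : Site d} : t ∈ ballBlocks d y₀ r ↔ supDist y₀ t ≤ r := by
  rw [ballBlocks, mem_image]
  constructor
  · rintro ⟨z, hz, rfl⟩
    rw [show z + y₀ = y₀ + z from add_comm _ _, supDist_add_left]
    exact mem_box_iff_supDist.1 hz
  · intro h
    refine ⟨t - y₀, mem_box_iff_supDist.2 ?_, sub_add_cancel t y₀⟩
    have := supDist_add_left y₀ (t - y₀)
    rw [add_sub_cancel] at this
    rwa [← this]

/-- `#ballBlocks = (2r+1)^d`. [folklore] -/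
theorem card_ballBlocks (y₀ : Site d) (r : ℕ) : #(ballBlocks d y₀ r) = (2 * r + 1) ^ d := by
  rw [ballBlocks, card_image_of_injective _ (add_left_injective y₀), card_box]

variable (d) in
/-- **Contour family (a)**: `★`-connected sets of exactly `N - 2` blocks with a point in the cube
`[0, N)^d`. [cite: FriedliVelenik2017, §10.4.2] -/
def famA (N : ℕ) : Finset (Finset (Site d)) :=
  open Classical in
  (box d (2 * N)).powerset.filter fun W => StarConn (W : Set (Site d)) ∧ #W + 2 = N ∧ ∃ w ∈ W, ∀ i, 0 ≤ w i ∧ w i < N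

variable (d) in
/-- **Contour family (b)**: `★`-connected sets `W` of `m' + 1 ≤ #W ≤ N - 2` blocks with a point within
sup-distance `#W` of the origin. [cite: FriedliVelenik2017, §10.4.2] -/
def famB (N m' : ℕ) : Finset (Finset (Site d)) :=
  open Classical in
  (box d (2 * N)).powerset.filter fun W => StarConn (W : Set (Site d)) ∧ m' + 1 ≤ #W ∧ #W + 2 ≤ N ∧ ∃ w ∈ W, supDist 0 w ≤ #W

variable (d) in
/-- **Contour family (c)**: `★`-connected sets `W` of `r + 1 ≤ #W ≤ N - 2` blocks with a point within
sup-distance `#W - 1` of `y₀`. [cite: FriedliVelenik2017, §10.4.2] -/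
def famC (N r : ℕ) (y₀ : Site d) : Finset (Finset (Site d)) :=
  open Classical in
  ((box d (2 * N)).image (· + y₀)).powerset.filter fun W =>
    StarConn (W : Set (Site d)) ∧ r + 1 ≤ #W ∧ #W + 2 ≤ N ∧ ∃ w ∈ W, supDist y₀ w + 1 ≤ #W

/-- Members of the contour families are `★`-connected and have at most `N - 2` blocks. [folklore] -/
theorem starConn_and_card_of_mem_fam {N m' r : ℕ} {y₀ : Site d} {W : Finset (Site d)}
    (hW : W ∈ famA d N ∪ famB d N m' ∪ famC d N r y₀) : StarConn (W : Set (Site d)) ∧ #W + 2 ≤ N := by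
  classical
  simp only [mem_union, famA, famB, famC, mem_filter] at hW
  rcases hW with (⟨-, h1, h2, -⟩ | ⟨-, h1, -, h2, -⟩) | ⟨-, h1, -, h2, -⟩
  · exact ⟨h1, h2.le⟩
  · exact ⟨h1, h2⟩
  · exact ⟨h1, h2⟩

/-- If `m < supDist x y` some coordinate differs by more than `m`. [folklore] -/
theorem exists_lt_natAbs_of_lt_supDist {x y : Site d} {m : ℕ} (h : m < supDist x y) : ∃ i, m < (x i - y i).natAbs := by
  by_contra hall
  push Not at hall
  exact absurd (supDist_le_iff.2 hall) (not_le.2 h)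

/-- Translation preserves `★`-connectedness. [folklore] -/
theorem starConn_image_add {S : Finset (Site d)} (hS : StarConn (S : Set (Site d))) (v : Site d) :
    StarConn ((S.image (· + v) : Finset (Site d)) : Set (Site d)) := by
  intro x hx y hy
  rw [coe_image] at hx hy ⊢
  obtain ⟨x₀, hx₀, rfl⟩ := hx
  obtain ⟨y₀, hy₀, rfl⟩ := hy
  have h := hS x₀ hx₀ y₀ hy₀
  clear hy₀
  induction h with
  | refl => exact ReflTransGen.refl
  | @tail u w _ huw ih =>
    refine ih.tail ⟨?_, Set.mem_image_of_mem _ huw.2.1, Set.mem_image_of_mem _ huw.2.2⟩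
    refine zdStar_adj_of_forall (fun h => huw.1.ne (add_right_cancel h)) fun j => ?_
    simp only [Pi.add_apply, add_sub_add_right_eq_sub]
    exact natAbs_sub_le_one_of_adj huw.1 j

/-- Floor division by `b ≥ 2` of an integer of absolute value `≤ 1` is `-1` or `0`. [folklore] -/
theorem ediv_bounds_of_abs_le_one (hb : 2 ≤ b) {z : ℤ} (hz : |z| ≤ 1) : -1 ≤ z / b ∧ z / b ≤ 0 := by
  have hbz : (0 : ℤ) < b := by exact_mod_cast (show 0 < b by omega)
  rw [abs_le] at hz
  constructor
  · exact Int.le_ediv_of_mul_le hbz (by linarith)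
  · have : z / b < 1 := Int.ediv_lt_of_lt_mul hbz (by linarith [(show (2 : ℤ) ≤ b by exact_mod_cast hb)])
    omega

/-- The block of a neighbour of the origin is within sup-distance `1` of the origin block (`b ≥ 2`).
[folklore] -/
theorem supDist_zero_blk_le_one (hb : 2 ≤ b) {u : Site d} (hu : (zdGraph d).Adj 0 u) : supDist 0 (blk b u) ≤ 1 := by
  rw [supDist_le_iff]
  intro i
  have h := abs_sub_le_one_of_zdGraph_adj hu i
  simp only [Pi.zero_apply, sub_zero] at h
  have := ediv_bounds_of_abs_le_one hb h
  simp only [Pi.zero_apply, zero_sub, Int.natAbs_neg, blk]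
  omega

/-- **A long `-` path through `Λ ⊆` internal sites together with a plus cube of blocks forces a long bad
contour** (the contour lemma applied to the blocks of the configuration; pointwise union bound).
For `m = b(m'+2)`: `𝟙[far event] · 𝟙[cube plus] ≤ ∑_{W ∈ contour families} 𝟙[all blocks of W bad]`.
[cite: FriedliVelenik2017, §10.4.2 (Peierls argument with chessboard estimates)] -/
theorem farInd_mul_plusAllInd_le_sum [NeZero (N * b)] (hd : 2 ≤ d) (hb : 2 ≤ b) (hN3 : 3 ≤ N)
    {Λ : Finset (Site d)} (hΛ : ∀ y ∈ Λ, ¬ IsSpImageSite d b y) (m' r : ℕ) (y₀ : Site d)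
    (σ : SpinConfig (TorusSite d (N * b))) :
    farInd Λ (b * (m' + 2)) (σ ∘ Torus.proj (N * b)) * plusAllInd N b (by omega) (ballBlocks d y₀ r) σ ≤
      ∑ W ∈ famA d N ∪ famB d N m' ∪ famC d N r y₀, allBadInd N b W σ := by
  classical
  have hd0 : 0 < d := by omega
  have hb0 : 0 < b := by omega
  have hbz : (0 : ℤ) < b := by exact_mod_cast hb0
  have hsum0 : 0 ≤ ∑ W ∈ famA d N ∪ famB d N m' ∪ famC d N r y₀, allBadInd N b W σ :=
    sum_nonneg fun W _ => allBadInd_nonneg W σ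
  by_cases hfar : FarEvent Λ (b * (m' + 2)) (σ ∘ Torus.proj (N * b))
  swap
  · rw [farInd, if_neg hfar, zero_mul]; exact hsum0
  by_cases hplus : ∀ t ∈ ballBlocks d y₀ r, PlusBlock N b hd0 t σ
  swap
  · rw [plusAllInd, if_neg hplus, mul_zero]; exact hsum0
  rw [farInd, if_pos hfar, plusAllInd, if_pos hplus, one_mul]
  -- the colouring of the blocks
  set Bad : Set (Site d) := {t | BadBlock N b t σ} with hBad
  set Plus : Set (Site d) := {t | PlusBlock N b hd0 t σ} with hPlus
  have hsep : ∀ a c : Site d, (zdStar d).Adj a c → a ∈ Plus → c ∉ Plus → c ∈ Bad :=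
    fun a c hac ha hc => badBlock_of_adj_plusBlock hd hb hac ha hc
  -- a `-` internal site makes its block non-plus
  have hnonplus : ∀ y : Site d, y ∈ Λ → σ (Torus.proj (N * b) y) = -1 → blk b y ∉ Plus := by
    intro y hy hσy hP
    have h1 := eq_one_of_plusBlock hd hb hP (self_mem_cellsOf _) (mem_freeCellZ.2 ⟨mem_cellZ_blk hb0 y, hΛ y hy⟩)
    rw [hσy] at h1; exact absurd h1 (by decide)
  obtain ⟨u, v, hu, huΛ, hσu, hv, hchain⟩ := hfar
  -- the block chain
  have hblkchain : ReflTransGen (starRel Plusᶜ) (blk b u) (blk b v) := by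
    clear hv
    induction hchain with
    | refl => exact ReflTransGen.refl
    | @tail a c _ hac ih =>
      rcases blk_adj_or_eq hb0 hac.1 with heq | hadj
      · rw [← heq]; exact ih
      · exact ih.tail ⟨hadj, hnonplus a hac.2.1.1 hac.2.1.2, hnonplus c hac.2.2.1 hac.2.2.2⟩
  have hdist : m' ≤ supDist (blk b u) (blk b v) := by
    obtain ⟨i, hi⟩ := exists_lt_natAbs_of_lt_supDist hv
    simp only [Pi.zero_apply, zero_sub, Int.natAbs_neg] at hi
    refine le_trans ?_ (natAbs_sub_le_supDist _ _ i)
    have hui : -1 ≤ blk b u i ∧ blk b u i ≤ 0 := by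
      have h := abs_sub_le_one_of_zdGraph_adj hu i
      simp only [Pi.zero_apply, sub_zero] at h
      exact ediv_bounds_of_abs_le_one hb h
    simp only [blk] at hui ⊢
    have hi' : ((b * (m' + 2) : ℕ) : ℤ) < ((v i).natAbs : ℤ) := by exact_mod_cast hi
    push_cast at hi'
    rcases le_or_gt 0 (v i) with h | h
    · -- `v i ≥ 0`
      have hvi : (b : ℤ) * (m' + 2) < v i := by rwa [abs_of_nonneg h] at hi'
      have h1 : (m' : ℤ) + 2 ≤ v i / b := Int.le_ediv_of_mul_le hbz (by linarith)
      omega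
    · -- `v i < 0`
      have hvi : v i < -((b : ℤ) * (m' + 2)) := by rw [abs_of_neg h] at hi'; linarith
      have h1 : v i / b < -((m' : ℤ) + 2) := Int.ediv_lt_of_lt_mul hbz (by linarith)
      omega
  have hy : ∀ z, supDist y₀ z ≤ r → z ∈ Plus := fun z hz => hplus z (mem_ballBlocks.2 hz)
  obtain ⟨W, hWconn, hWbad, hcases⟩ := exists_starConn_bad_of_chain hd hsep (N := N - 2) (by omega)
    (hnonplus u huΛ hσu) ⟨blk b v, hblkchain, hdist⟩ hy
  have hWbad' : ∀ t ∈ W, BadBlock N b t σ := fun t ht => hWbad t ht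
  have hWall : allBadInd N b W σ = 1 := by rw [allBadInd, if_pos hWbad']
  -- exhibit a member of the families with indicator `1`
  suffices hmem : ∃ W' ∈ famA d N ∪ famB d N m' ∪ famC d N r y₀, allBadInd N b W' σ = 1 by
    obtain ⟨W', hW', h1⟩ := hmem
    rw [← h1]
    exact single_le_sum (fun W _ => allBadInd_nonneg W σ) hW'
  have hdiam : ∀ t ∈ W, ∀ t' ∈ W, supDist t t' + 1 ≤ #W := fun t ht t' ht' => supDist_lt_card_of_starConn hWconn ht ht'
  rcases hcases with hA | ⟨hm, hlt, w₀, hw₀, hdw₀⟩ | ⟨hr, hlt, w₀, hw₀, hdw₀⟩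
  · -- (a): translate a point of `W` into `[0, N)^d`
    have hWne : W.Nonempty := card_pos.1 (by omega)
    obtain ⟨w, hw⟩ := hWne
    set q : Site d := fun i => (N : ℤ) * (w i / N) with hq
    set W' := W.image (· + -q) with hW'
    have hN0 : (0 : ℤ) < N := by exact_mod_cast (show 0 < N by omega)
    have hwq : ∀ i, 0 ≤ (w + -q) i ∧ (w + -q) i < N := by
      intro i
      simp only [Pi.add_apply, Pi.neg_apply, hq]
      have h1 := Int.emod_add_mul_ediv (w i) N
      have h2 := Int.emod_nonneg (w i) hN0.ne'
      have h3 := Int.emod_lt_of_pos (w i) hN0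
      constructor <;> linarith [mul_comm (N : ℤ) (w i / N)]
    refine ⟨W', mem_union_left _ (mem_union_left _ ?_), ?_⟩
    · simp only [famA, mem_filter, mem_powerset]
      refine ⟨fun t' ht' => ?_, starConn_image_add hWconn _, ?_, ⟨w + -q, mem_image_of_mem _ hw, hwq⟩⟩
      · obtain ⟨t, ht, rfl⟩ := mem_image.1 ht'
        rw [mem_box]
        intro i
        have h1 := hdiam t ht w hw
        have h2 := natAbs_sub_le_supDist t w i
        have h3 := hwq i
        simp only [Pi.add_apply, Pi.neg_apply] at h3 ⊢
        push_cast
        constructor <;> omega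
      · rw [hW', card_image_of_injective _ (add_left_injective (-q))]
        omega
    · rw [allBadInd, if_pos]
      intro t' ht'
      obtain ⟨t, ht, rfl⟩ := mem_image.1 ht'
      have := (badBlock_add_period t (fun i => -(w i / N)) σ).2 (hWbad' t ht)
      convert this using 2
      funext i; simp [hq]
  · -- (b)
    refine ⟨W, mem_union_left _ (mem_union_right _ ?_), hWall⟩
    simp only [famB, mem_filter, mem_powerset]
    have hx1 : supDist 0 (blk b u) ≤ 1 := supDist_zero_blk_le_one hb hu
    have hw₀0 : supDist 0 w₀ ≤ #W := by
      have := supDist_triangle 0 (blk b u) w₀; omega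
    refine ⟨fun t ht => mem_box_iff_supDist.2 ?_, hWconn, hm, by omega, w₀, hw₀, hw₀0⟩
    have h1 := hdiam w₀ hw₀ t ht
    have := supDist_triangle 0 w₀ t
    omega
  · -- (c)
    refine ⟨W, mem_union_right _ ?_, hWall⟩
    simp only [famC, mem_filter, mem_powerset]
    refine ⟨fun t ht => ?_, hWconn, hr, by omega, w₀, hw₀, hdw₀⟩
    refine mem_image.2 ⟨t - y₀, mem_box_iff_supDist.2 ?_, sub_add_cancel t y₀⟩
    have h1 := hdiam w₀ hw₀ t ht
    have h2 := supDist_triangle y₀ w₀ t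
    have h3 := supDist_add_left y₀ (t - y₀)
    rw [add_sub_cancel] at h3
    omega

variable [NeZero N] [NeZero (N * b)]

/-- **The chessboard–Peierls bound on the torus**: the probability that a long `-` path from a neighbour
of the origin coexists with a plus cube is at most `∑_{W ∈ contour families} ε_blk^{#W}`.
[cite: FriedliVelenik2017, §10.4.2 and Theorem 10.11] -/
theorem tExpect_farInd_mul_plusAllInd_le {n : ℕ} (hd : 2 ≤ d) (hNn : N = 2 ^ (n + 1)) (hN3 : 3 ≤ N) (hb : 2 ≤ b)
    (p : ℤˣ) {β : ℝ} (hβ : 0 ≤ β) (hρ : (2 : ℝ) ^ (b ^ d) * Real.exp (-β / 4 ^ d) ≤ 1)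
    {Λ : Finset (Site d)} (hΛ : ∀ y ∈ Λ, ¬ IsSpImageSite d b y) (m' r : ℕ) (y₀ : Site d) :
    tExpect N b p β (fun σ => farInd Λ (b * (m' + 2)) (σ ∘ Torus.proj (N * b)) *
        plusAllInd N b (by omega) (ballBlocks d y₀ r) σ) ≤
      ∑ W ∈ famA d N ∪ famB d N m' ∪ famC d N r y₀, epsBlk d b β ^ #W := by
  calc _ ≤ tExpect N b p β (fun σ => ∑ W ∈ famA d N ∪ famB d N m' ∪ famC d N r y₀, allBadInd N b W σ) :=
        tExpect_mono hb p β fun σ => farInd_mul_plusAllInd_le_sum hd hb hN3 hΛ m' r y₀ σ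
    _ = ∑ W ∈ famA d N ∪ famB d N m' ∪ famC d N r y₀, tExpect N b p β (allBadInd N b W) := tExpect_finset_sum hb p β _ _
    _ ≤ _ := sum_le_sum fun W hW => by
        obtain ⟨hc, hcard⟩ := starConn_and_card_of_mem_fam hW
        exact tExpect_allBadInd_le_pow hd hNn hb p hβ hρ hc hcard

end FarEvents

/-! ### Counting the contour families -/

section Counting

/-- The `★`-graph of `ℤ^d` is locally finite: the neighbours of `x` are the other points of its
`★`-ball. [cite: FriedliVelenik2017, App. B.15] -/
instance zdStar.instLocallyFinite : (zdStar d).LocallyFinite := fun x =>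
  Fintype.ofFinset ((starBall x).erase x) fun y => by
    rw [mem_erase, SimpleGraph.mem_neighborSet, adj_iff_mem_starBall]
    tauto

/-- Degrees of the `★`-graph are at most `3^d`. [cite: FriedliVelenik2017, App. B.15] -/
theorem degree_zdStar_le (x : Site d) : (zdStar d).degree x ≤ 3 ^ d := by
  rw [← card_starBall x, SimpleGraph.degree]
  refine card_le_card fun y hy => ?_
  rw [SimpleGraph.mem_neighborFinset] at hy
  exact (adj_iff_mem_starBall.1 hy).1

/-- **Lattice-animal bound for `★`-connected sets through a point** (Friedli–Velenik (5.27) via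
Lemma 3.38): a family of `★`-connected `k`-sets all containing `w` has at most `(3^d)^{2(k-1)}`
members. [cite: FriedliVelenik2017, eq. (5.27) with Lemma 3.38] -/
theorem card_le_pow_of_starConn_mem (𝒜 : Finset (Finset (Site d))) {w : Site d} {k : ℕ}
    (h𝒜 : ∀ W ∈ 𝒜, w ∈ W ∧ #W = k ∧ StarConn (W : Set (Site d))) : #𝒜 ≤ (3 ^ d) ^ (2 * (k - 1)) :=
  card_le_pow_of_isGraphConnected (G := zdStar d) degree_zdStar_le 𝒜 fun W hW =>
    ⟨(h𝒜 W hW).1, (h𝒜 W hW).2.1, (starConn_iff_isGraphConnected W).1 (h𝒜 W hW).2.2⟩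

/-- **Anchored lattice-animal bound**: a family of `★`-connected `k`-sets each containing a point of a
finite set `P` has at most `#P · (3^d)^{2(k-1)}` members. [cite: FriedliVelenik2017, eq. (5.27)] -/
theorem card_le_mul_pow_of_starConn_meets (𝒜 : Finset (Finset (Site d))) (P : Finset (Site d)) {k : ℕ}
    (h𝒜 : ∀ W ∈ 𝒜, (∃ w ∈ W, w ∈ P) ∧ #W = k ∧ StarConn (W : Set (Site d))) :
    #𝒜 ≤ #P * (3 ^ d) ^ (2 * (k - 1)) := by
  classical
  have hsub : 𝒜 ⊆ P.biUnion fun w => 𝒜.filter fun W => w ∈ W := by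
    intro W hW
    obtain ⟨⟨w, hwW, hwP⟩, -, -⟩ := h𝒜 W hW
    exact mem_biUnion.2 ⟨w, hwP, mem_filter.2 ⟨hW, hwW⟩⟩
  calc #𝒜 ≤ #(P.biUnion fun w => 𝒜.filter fun W => w ∈ W) := card_le_card hsub
    _ ≤ ∑ w ∈ P, #(𝒜.filter fun W => w ∈ W) := card_biUnion_le
    _ ≤ ∑ _w ∈ P, (3 ^ d) ^ (2 * (k - 1)) := sum_le_sum fun w _ =>
        card_le_pow_of_starConn_mem _ fun W hW => ⟨(mem_filter.1 hW).2, (h𝒜 W (mem_filter.1 hW).1).2⟩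
    _ = #P * (3 ^ d) ^ (2 * (k - 1)) := by rw [sum_const, smul_eq_mul]

variable (d) in
/-- **The contour sum** bounding the chessboard–Peierls probability:
`N^d Δ^{2(N-3)} ε^{N-2} + ∑_{k=m'+1}^{N-2} (2k+1)^d Δ^{2(k-1)} ε^k + ∑_{k=r+1}^{N-2} (2k+1)^d Δ^{2(k-1)} ε^k`,
`Δ = 3^d`. [cite: FriedliVelenik2017, §10.4.2] -/
def contourSum (N m' r : ℕ) (ε : ℝ) : ℝ :=
  (N : ℝ) ^ d * ((3 : ℝ) ^ d) ^ (2 * (N - 3)) * ε ^ (N - 2) +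
    (∑ k ∈ Ico (m' + 1) (N - 1), ((2 * k + 1 : ℕ) : ℝ) ^ d * ((3 : ℝ) ^ d) ^ (2 * (k - 1)) * ε ^ k) +
    ∑ k ∈ Ico (r + 1) (N - 1), ((2 * k + 1 : ℕ) : ℝ) ^ d * ((3 : ℝ) ^ d) ^ (2 * (k - 1)) * ε ^ k

/-- Sums over a union of families are at most the sums over the pieces (nonnegative terms). [folklore] -/
theorem sum_pow_card_union_le (A B : Finset (Finset (Site d))) {ε : ℝ} (hε : 0 ≤ ε) :
    ∑ W ∈ A ∪ B, ε ^ #W ≤ ∑ W ∈ A, ε ^ #W + ∑ W ∈ B, ε ^ #W := by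
  classical
  rw [← sum_union_inter]
  linarith [sum_nonneg (s := A ∩ B) fun W _ => pow_nonneg hε #W]

/-- **Counting family (a)**: `∑_{W ∈ famA} ε^{#W} ≤ N^d Δ^{2(N-3)} ε^{N-2}`. [cite: FriedliVelenik2017, eq. (5.27)] -/
theorem sum_famA_le (N : ℕ) {ε : ℝ} (hε : 0 ≤ ε) :
    ∑ W ∈ famA d N, ε ^ #W ≤ (N : ℝ) ^ d * ((3 : ℝ) ^ d) ^ (2 * (N - 3)) * ε ^ (N - 2) := by
  classical
  have hpow : ∀ W ∈ famA d N, ε ^ #W = ε ^ (N - 2) := fun W hW => by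
    have h := (mem_filter.1 hW).2.2.1
    rw [show #W = N - 2 by omega]
  rw [sum_congr rfl hpow, sum_const, nsmul_eq_mul]
  refine mul_le_mul_of_nonneg_right ?_ (pow_nonneg hε _)
  set P : Finset (Site d) := Fintype.piFinset fun _ : Fin d => Finset.Ico (0 : ℤ) N with hP
  have hPcard : #P = N ^ d := by
    rw [hP, Fintype.card_piFinset_const, Int.card_Ico]; simp
  have h := card_le_mul_pow_of_starConn_meets (famA d N) P (k := N - 2) fun W hW => by
    obtain ⟨-, hconn, hcard, w, hw, hwN⟩ := mem_filter.1 hW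
    exact ⟨⟨w, hw, Fintype.mem_piFinset.2 fun i => Finset.mem_Ico.2 (hwN i)⟩, by omega, hconn⟩
  have h23 : 2 * (N - 2 - 1) = 2 * (N - 3) := by omega
  rw [hPcard, h23] at h
  calc (#(famA d N) : ℝ) ≤ ((N ^ d * (3 ^ d) ^ (2 * (N - 3)) : ℕ) : ℝ) := Nat.cast_le.2 h
    _ = (N : ℝ) ^ d * ((3 : ℝ) ^ d) ^ (2 * (N - 3)) := by push_cast; ring

/-- **Counting an anchored family fiberwise in the cardinality**: if every member `W` of `𝒜` is
`★`-connected with `a + 1 ≤ #W ≤ N - 2` and contains a point of `Q(#W)`, `#Q(k) ≤ (2k+1)^d`, then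
`∑_{W ∈ 𝒜} ε^{#W} ≤ ∑_{k=a+1}^{N-2} (2k+1)^d Δ^{2(k-1)} ε^k`. [cite: FriedliVelenik2017, eq. (5.27)] -/
theorem sum_le_of_anchored {N : ℕ} (𝒜 : Finset (Finset (Site d))) (a : ℕ) (Q : ℕ → Finset (Site d))
    (hQ : ∀ k, #(Q k) ≤ (2 * k + 1) ^ d)
    (h𝒜 : ∀ W ∈ 𝒜, a + 1 ≤ #W ∧ #W + 2 ≤ N ∧ StarConn (W : Set (Site d)) ∧ ∃ w ∈ W, w ∈ Q #W) {ε : ℝ} (hε : 0 ≤ ε) :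
    ∑ W ∈ 𝒜, ε ^ #W ≤ ∑ k ∈ Ico (a + 1) (N - 1), ((2 * k + 1 : ℕ) : ℝ) ^ d * ((3 : ℝ) ^ d) ^ (2 * (k - 1)) * ε ^ k := by
  classical
  rw [← sum_fiberwise_of_maps_to (g := fun W : Finset (Site d) => #W) (t := Ico (a + 1) (N - 1))
    (fun W hW => Finset.mem_Ico.2 ⟨(h𝒜 W hW).1, by have := (h𝒜 W hW).2.1; omega⟩)]
  refine sum_le_sum fun k _ => ?_
  have hk : ∀ W ∈ 𝒜.filter (fun W => #W = k), ε ^ #W = ε ^ k := fun W hW => by rw [(mem_filter.1 hW).2]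
  rw [sum_congr rfl hk, sum_const, nsmul_eq_mul]
  refine mul_le_mul_of_nonneg_right ?_ (pow_nonneg hε _)
  have h := card_le_mul_pow_of_starConn_meets (𝒜.filter fun W => #W = k) (Q k) (k := k) fun W hW => by
    obtain ⟨hW, hWk⟩ := mem_filter.1 hW
    obtain ⟨-, -, hconn, w, hw, hwQ⟩ := h𝒜 W hW
    exact ⟨⟨w, hw, hWk ▸ hwQ⟩, hWk, hconn⟩
  have h2 : #(𝒜.filter fun W => #W = k) ≤ (2 * k + 1) ^ d * (3 ^ d) ^ (2 * (k - 1)) :=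
    h.trans (Nat.mul_le_mul_right _ (hQ k))
  calc (#(𝒜.filter fun W => #W = k) : ℝ) ≤ (((2 * k + 1) ^ d * (3 ^ d) ^ (2 * (k - 1)) : ℕ) : ℝ) := Nat.cast_le.2 h2
    _ = ((2 * k + 1 : ℕ) : ℝ) ^ d * ((3 : ℝ) ^ d) ^ (2 * (k - 1)) := by push_cast; ring

/-- **Counting family (b).** [cite: FriedliVelenik2017, eq. (5.27)] -/
theorem sum_famB_le (N m' : ℕ) {ε : ℝ} (hε : 0 ≤ ε) :
    ∑ W ∈ famB d N m', ε ^ #W ≤ ∑ k ∈ Ico (m' + 1) (N - 1), ((2 * k + 1 : ℕ) : ℝ) ^ d * ((3 : ℝ) ^ d) ^ (2 * (k - 1)) * ε ^ k := by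
  classical
  refine sum_le_of_anchored (N := N) (famB d N m') m' (fun k => box d k) (fun k => (card_box d k).le) (fun W hW => ?_) hε
  have hW' := (mem_filter.1 hW).2
  obtain ⟨hconn, h1, h2, w, hw, hw0⟩ := hW'
  exact ⟨h1, h2, hconn, w, hw, mem_box_iff_supDist.2 hw0⟩

/-- **Counting family (c).** [cite: FriedliVelenik2017, eq. (5.27)] -/
theorem sum_famC_le (N r : ℕ) (y₀ : Site d) {ε : ℝ} (hε : 0 ≤ ε) :
    ∑ W ∈ famC d N r y₀, ε ^ #W ≤ ∑ k ∈ Ico (r + 1) (N - 1), ((2 * k + 1 : ℕ) : ℝ) ^ d * ((3 : ℝ) ^ d) ^ (2 * (k - 1)) * ε ^ k := by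
  classical
  refine sum_le_of_anchored (N := N) (famC d N r y₀) r (fun k => (box d k).image (· + y₀))
    (fun k => ?_) (fun W hW => ?_) hε
  · rw [card_image_of_injective _ (add_left_injective y₀), card_box]
  · have hW' := (mem_filter.1 hW).2
    obtain ⟨hconn, h1, h2, w, hw, hw0⟩ := hW'
    refine ⟨h1, h2, hconn, w, hw, mem_image.2 ⟨w - y₀, mem_box_iff_supDist.2 ?_, sub_add_cancel w y₀⟩⟩
    have h3 := supDist_add_left y₀ (w - y₀)
    rw [add_sub_cancel] at h3
    rw [← h3]; omega

/-- Unfolding `contourSum`. [folklore] -/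
theorem contourSum_eq (N m' r : ℕ) (ε : ℝ) :
    contourSum d N m' r ε = (N : ℝ) ^ d * ((3 : ℝ) ^ d) ^ (2 * (N - 3)) * ε ^ (N - 2) +
    (∑ k ∈ Ico (m' + 1) (N - 1), ((2 * k + 1 : ℕ) : ℝ) ^ d * ((3 : ℝ) ^ d) ^ (2 * (k - 1)) * ε ^ k) +
    ∑ k ∈ Ico (r + 1) (N - 1), ((2 * k + 1 : ℕ) : ℝ) ^ d * ((3 : ℝ) ^ d) ^ (2 * (k - 1)) * ε ^ k := rfl

/-- **Counting the contour families**: `∑_{W ∈ famA ∪ famB ∪ famC} ε^{#W} ≤ contourSum` (`ε ≥ 0`).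
[cite: FriedliVelenik2017, §10.4.2 and eq. (5.27)] -/
theorem sum_fam_le_contourSum {N : ℕ} (m' r : ℕ) (y₀ : Site d) {ε : ℝ} (hε : 0 ≤ ε) :
    ∑ W ∈ famA d N ∪ famB d N m' ∪ famC d N r y₀, ε ^ #W ≤ contourSum d N m' r ε := by
  have h1 := sum_pow_card_union_le (famA d N ∪ famB d N m') (famC d N r y₀) hε
  have h2 := sum_pow_card_union_le (famA d N) (famB d N m') hε
  have h3 := add_le_add (add_le_add (sum_famA_le (d := d) N hε) (sum_famB_le (d := d) N m' hε)) (sum_famC_le N r y₀ hε)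
  have h4 := contourSum_eq (d := d) N m' r ε
  linarith

/-- `N ≤ 3^{N-2}` for `N ≥ 3`. [folklore] -/
theorem cast_le_three_pow_sub_two {N : ℕ} (hN : 3 ≤ N) : (N : ℝ) ≤ 3 ^ (N - 2) := by
  have key : ∀ k : ℕ, ((k + 3 : ℕ) : ℝ) ≤ 3 ^ (k + 1) := by
    intro k
    induction k with
    | zero => norm_num
    | succ k ih =>
      rw [pow_succ]
      push_cast at ih ⊢
      linarith
  obtain ⟨k, rfl⟩ : ∃ k, N = k + 3 := ⟨N - 3, by omega⟩
  rw [show k + 3 - 2 = k + 1 by omega]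
  exact key k

/-- `2k + 1 ≤ 3^k`. [folklore] -/
theorem two_mul_add_one_le_three_pow (k : ℕ) : ((2 * k + 1 : ℕ) : ℝ) ≤ 3 ^ k := by
  induction k with
  | zero => norm_num
  | succ k ih =>
    rw [pow_succ]; push_cast at ih ⊢
    nlinarith [ih, (show (1 : ℝ) ≤ 3 ^ k from one_le_pow₀ (by norm_num))]

/-- The terms of the contour sum are dominated by a geometric sequence:
`(2k+1)^d Δ^{2(k-1)} ε^k ≤ (27^d ε)^k`. [folklore] -/
theorem contour_term_le (k : ℕ) {ε : ℝ} (hε : 0 ≤ ε) :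
    ((2 * k + 1 : ℕ) : ℝ) ^ d * ((3 : ℝ) ^ d) ^ (2 * (k - 1)) * ε ^ k ≤ ((27 : ℝ) ^ d * ε) ^ k := by
  have hswap : ((3 : ℝ) ^ k) ^ d = ((3 : ℝ) ^ d) ^ k := by rw [← pow_mul, ← pow_mul, mul_comm]
  have h1 : ((2 * k + 1 : ℕ) : ℝ) ^ d ≤ ((3 : ℝ) ^ d) ^ k := by
    rw [← hswap]
    exact pow_le_pow_left₀ (by positivity) (two_mul_add_one_le_three_pow k) d
  have h3d : (1 : ℝ) ≤ (3 : ℝ) ^ d := one_le_pow₀ (by norm_num)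
  have h2 : ((3 : ℝ) ^ d) ^ (2 * (k - 1)) ≤ (((3 : ℝ) ^ d) ^ 2) ^ k := by
    rw [← pow_mul ((3 : ℝ) ^ d) 2 k]
    exact pow_le_pow_right₀ h3d (by omega)
  have h27 : (27 : ℝ) ^ d = (3 : ℝ) ^ d * ((3 : ℝ) ^ d) ^ 2 := by
    rw [show (27 : ℝ) = 3 ^ 3 by norm_num, ← pow_mul]; ring
  rw [h27, mul_pow, mul_pow]
  have h3 : 0 ≤ ε ^ k := pow_nonneg hε k
  have h4 : 0 ≤ ((3 : ℝ) ^ d) ^ k := by positivity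
  calc _ ≤ ((3 : ℝ) ^ d) ^ k * (((3 : ℝ) ^ d) ^ 2) ^ k * ε ^ k := by gcongr
    _ = _ := by ring

/-- **Simplified contour sum**: with `r = m'`, `m' + 3 ≤ N`, `27^d ε ≤ 1/2`:
`contourSum ≤ 5 (27^d ε)^{m'+1}`. [cite: FriedliVelenik2017, §10.4.2] -/
theorem contourSum_le {N : ℕ} (hN : 3 ≤ N) (m' : ℕ) (hmN : m' + 3 ≤ N) {ε : ℝ} (hε : 0 ≤ ε)
    (hq : (27 : ℝ) ^ d * ε ≤ 1 / 2) :
    contourSum d N m' m' ε ≤ 5 * ((27 : ℝ) ^ d * ε) ^ (m' + 1) := by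
  set q : ℝ := (27 : ℝ) ^ d * ε with hqdef
  have hq0 : 0 ≤ q := by positivity
  have hq1 : q < 1 := by linarith
  have hqle1 : q ≤ 1 := hq1.le
  -- term (a)
  have ha : (N : ℝ) ^ d * ((3 : ℝ) ^ d) ^ (2 * (N - 3)) * ε ^ (N - 2) ≤ q ^ (m' + 1) := by
    have h1 : (N : ℝ) ^ d ≤ ((3 : ℝ) ^ d) ^ (N - 2) := by
      rw [show ((3 : ℝ) ^ d) ^ (N - 2) = ((3 : ℝ) ^ (N - 2)) ^ d by rw [← pow_mul, ← pow_mul, mul_comm]]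
      exact pow_le_pow_left₀ (by positivity) (cast_le_three_pow_sub_two hN) d
    have h3d : (1 : ℝ) ≤ (3 : ℝ) ^ d := one_le_pow₀ (by norm_num)
    have h2 : ((3 : ℝ) ^ d) ^ (2 * (N - 3)) ≤ (((3 : ℝ) ^ d) ^ 2) ^ (N - 2) := by
      rw [← pow_mul ((3 : ℝ) ^ d) 2 (N - 2)]; exact pow_le_pow_right₀ h3d (by omega)
    have h27 : (27 : ℝ) ^ d = (3 : ℝ) ^ d * ((3 : ℝ) ^ d) ^ 2 := by
      rw [show (27 : ℝ) = 3 ^ 3 by norm_num, ← pow_mul]; ring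
    calc _ ≤ ((3 : ℝ) ^ d) ^ (N - 2) * (((3 : ℝ) ^ d) ^ 2) ^ (N - 2) * ε ^ (N - 2) := by
          have : 0 ≤ ε ^ (N - 2) := pow_nonneg hε _
          gcongr
      _ = q ^ (N - 2) := by rw [hqdef, h27, mul_pow, mul_pow]
      _ ≤ q ^ (m' + 1) := pow_le_pow_of_le_one hq0 hqle1 (by omega)
  -- terms (b) = (c)
  have hb : ∑ k ∈ Ico (m' + 1) (N - 1), ((2 * k + 1 : ℕ) : ℝ) ^ d * ((3 : ℝ) ^ d) ^ (2 * (k - 1)) * ε ^ k ≤ 2 * q ^ (m' + 1) := by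
    calc _ ≤ ∑ k ∈ Ico (m' + 1) (N - 1), q ^ k := sum_le_sum fun k _ => contour_term_le k hε
      _ ≤ q ^ (m' + 1) / (1 - q) := geom_sum_Ico_le_of_lt_one hq0 hq1
      _ ≤ 2 * q ^ (m' + 1) := by
          rw [div_le_iff₀ (by linarith)]
          nlinarith [pow_nonneg hq0 (m' + 1)]
  unfold contourSum
  linarith

end Counting

/-! ### The far bound in the `+`-exterior box -/

section FarBound

variable {N b : ℕ}

/-- Translation invariance of the sup-distance. [folklore] -/
theorem supDist_add_right (x y e : Site d) : supDist (x + e) (y + e) = supDist x y := by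
  unfold supDist; congr 1; funext i; simp

variable (d) in
/-- The centre `(R' + r + 3) e₀` of the plus cube used to condition the torus. [folklore] -/
def cubeCenter (hd : 0 < d) (R' r : ℕ) : Site d := fun j => if j = ⟨0, hd⟩ then ((R' + r + 3 : ℕ) : ℤ) else 0

/-- A cube of blocks is `★`-connected. [folklore] -/
theorem starConn_ballBlocks (y₀ : Site d) (r : ℕ) : StarConn ((ballBlocks d y₀ r : Finset (Site d)) : Set (Site d)) := by
  intro t ht t' ht'
  rw [mem_coe, mem_ballBlocks] at ht ht'
  refine reflTransGen_starRel_of_between t t' fun z hz => ?_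
  rw [mem_coe, mem_ballBlocks, supDist_le_iff]
  intro i
  have h1 := (supDist_le_iff.1 ht) i
  have h2 := (supDist_le_iff.1 ht') i
  obtain ⟨hz1, hz2⟩ := hz i
  rcases le_total (t i) (t' i) with hle | hle
  · rw [min_eq_left hle] at hz1; rw [max_eq_right hle] at hz2; omega
  · rw [min_eq_right hle] at hz1; rw [max_eq_left hle] at hz2; omega

/-- The shifted cube is the cube about the shifted centre. [folklore] -/
theorem ballBlocks_image_add (y₀ e : Site d) (r : ℕ) : (ballBlocks d y₀ r).image (· + e) = ballBlocks d (y₀ + e) r := by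
  ext t
  rw [mem_image, mem_ballBlocks]
  constructor
  · rintro ⟨t₀, ht₀, rfl⟩
    rw [supDist_add_right]; exact mem_ballBlocks.1 ht₀
  · intro h
    refine ⟨t - e, mem_ballBlocks.2 ?_, sub_add_cancel t e⟩
    rwa [← supDist_add_right y₀ (t - e) e, sub_add_cancel]

/-- The cube together with its unit shift is `★`-connected. [folklore] -/
theorem starConn_ballBlocks_union (y₀ : Site d) (r : ℕ) (i : Fin d) :
    StarConn ((ballBlocks d y₀ r ∪ (ballBlocks d y₀ r).image (· + Pi.single i 1) : Finset (Site d)) : Set (Site d)) := by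
  set e : Site d := Pi.single i 1 with he
  set U : Finset (Site d) := ballBlocks d y₀ r ∪ (ballBlocks d y₀ r).image (· + e) with hU
  have hsub1 : ((ballBlocks d y₀ r : Finset (Site d)) : Set (Site d)) ⊆ (U : Set (Site d)) := by
    rw [hU, coe_union]; exact Set.subset_union_left
  have hsub2 : ((ballBlocks d (y₀ + e) r : Finset (Site d)) : Set (Site d)) ⊆ (U : Set (Site d)) := by
    rw [hU, coe_union, ballBlocks_image_add]; exact Set.subset_union_right
  have hy₀ : y₀ ∈ ballBlocks d y₀ r := mem_ballBlocks.2 (by simp)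
  have hy₀e : y₀ + e ∈ ballBlocks d (y₀ + e) r := mem_ballBlocks.2 (by simp)
  have hadj : (zdStar d).Adj (y₀ + e) y₀ := by
    have h := (adj_update_succ y₀ i (y₀ i)).symm
    rw [Function.update_eq_self] at h
    convert h using 1
    funext j; by_cases hj : j = i
    · subst hj; simp [he]
    · simp [he, hj]
  -- every point is chained to `y₀` inside `U`
  have hto : ∀ x ∈ (U : Set (Site d)), ReflTransGen (starRel (U : Set (Site d))) x y₀ := by
    intro x hx
    rw [hU, coe_union, ballBlocks_image_add] at hx
    rcases hx with hx | hx
    · exact reflTransGen_starRel_mono hsub1 (starConn_ballBlocks y₀ r x hx y₀ (mem_coe.2 hy₀))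
    · have h1 := reflTransGen_starRel_mono hsub2 (starConn_ballBlocks (y₀ + e) r x hx (y₀ + e) (mem_coe.2 hy₀e))
      exact h1.tail ⟨hadj, hsub2 (mem_coe.2 hy₀e), hsub1 (mem_coe.2 hy₀)⟩
  intro x hx y hy
  exact (hto x hx).trans (reflTransGen_starRel_symm (hto y hy))

/-- The reflection `t ↦ t[0 ↦ 2(c+1) - t₀]` through the block boundary past the centre maps the
cube onto its double shift. [folklore] -/
theorem ballBlocks_image_reflect (hd : 0 < d) (R' r : ℕ) :
    (ballBlocks d (cubeCenter d hd R' r) r).image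
        (fun t => Function.update t ⟨0, hd⟩ (2 * (((R' + r + 3 : ℕ) : ℤ) + 1) - t ⟨0, hd⟩)) =
      (ballBlocks d (cubeCenter d hd R' r) r).image (· + Pi.single ⟨0, hd⟩ 1 + Pi.single ⟨0, hd⟩ 1) := by
  set i₀ : Fin d := ⟨0, hd⟩ with hi₀
  set y₀ := cubeCenter d hd R' r with hy₀
  set R : Site d → Site d := fun t => Function.update t i₀ (2 * (((R' + r + 3 : ℕ) : ℤ) + 1) - t i₀) with hR
  have hRR : ∀ t, R (R t) = t := fun t => by
    ext j; by_cases hj : j = i₀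
    · subst hj; simp [hR]
    · simp [hR, hj]
  have hy₀0 : y₀ i₀ = ((R' + r + 3 : ℕ) : ℤ) := by simp [hy₀, cubeCenter, hi₀]
  -- the two preimage conditions coincide
  have hdist : ∀ t, supDist y₀ (R t) = supDist y₀ (t - (Pi.single i₀ 1 + Pi.single i₀ 1)) := by
    intro t
    unfold supDist; congr 1; funext j
    by_cases hj : j = i₀
    · subst hj
      simp only [hR, Function.update_self, Pi.sub_apply, Pi.add_apply, Pi.single_eq_same, hy₀0]
      omega
    · simp [hR, hj]
  ext t
  simp only [mem_image]
  constructor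
  · rintro ⟨t₀, ht₀, rfl⟩
    refine ⟨R t₀ - (Pi.single i₀ 1 + Pi.single i₀ 1), mem_ballBlocks.2 ?_, by rw [add_assoc, sub_add_cancel]⟩
    rw [← hdist, hRR]; exact mem_ballBlocks.1 ht₀
  · rintro ⟨t₀, ht₀, rfl⟩
    refine ⟨R (t₀ + Pi.single i₀ 1 + Pi.single i₀ 1), mem_ballBlocks.2 ?_, hRR _⟩
    rw [hdist, add_assoc, add_sub_cancel_right]; exact mem_ballBlocks.1 ht₀

/-- Expectations of nonnegative observables are nonnegative. [folklore] -/
theorem isingExpect_nonneg_of_nonneg {V : Type*} [DecidableEq V] (G : SimpleGraph V) [G.LocallyFinite] (Λ : Finset V) (β h : ℝ)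
    (bc : BoundaryCondition V) {f : SpinConfig V → ℝ} (hf : ∀ σ, 0 ≤ f σ) : 0 ≤ isingExpect G Λ β h bc f := by
  unfold isingExpect; exact MeasureTheory.integral_nonneg hf

variable [NeZero N] [NeZero (N * b)]

omit [NeZero N] [NeZero (N * b)] in
/-- **The plus cube is insensitive to the spins of the embedded box**: for `N ≥ 2R' + 2r + 5` the sites of
the blocks of the cube about `(R'+r+3)e₀` project to torus sites distinct from the projections of the
internal sites of `box d (bR')`. [folklore] -/
theorem plusAllInd_ballBlocks_local (hd : 2 ≤ d) (hb : 2 ≤ b) (R' r : ℕ) (hfit : 2 * R' + 2 * r + 5 ≤ N)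
    {σ σ' : SpinConfig (TorusSite d (N * b))}
    (h : ∀ x, x ∉ (spacingIntVolume d b R').image (Torus.proj (N * b)) → σ x = σ' x) :
    plusAllInd N b (by omega) (ballBlocks d (cubeCenter d (by omega) R' r) r) σ =
      plusAllInd N b (by omega) (ballBlocks d (cubeCenter d (by omega) R' r) r) σ' := by
  have hd0 : 0 < d := by omega
  refine plusAllInd_congr (by omega) (fun t ht c hc y hy => h _ fun hmem => ?_) hb
  obtain ⟨z, hz, hzy⟩ := mem_image.1 hmem
  have hcc : cubeCenter d hd0 R' r ⟨0, hd0⟩ = ((R' + r + 3 : ℕ) : ℤ) := by simp [cubeCenter]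
  have ht0 := (supDist_le_iff.1 (mem_ballBlocks.1 ht)) ⟨0, hd0⟩
  rw [hcc] at ht0
  have hc0 := (mem_cellsOf.1 hc) ⟨0, hd0⟩
  have hy0 := (mem_cellZ.1 (mem_freeCellZ.1 hy).1) ⟨0, hd0⟩
  have hz0 := (mem_box.1 (mem_spacingIntVolume.1 hz).1) ⟨0, hd0⟩
  have hproj := congrFun hzy ⟨0, hd0⟩
  simp only [Torus.proj] at hproj
  rw [ZMod.intCast_eq_intCast_iff_dvd_sub] at hproj
  obtain ⟨c', hc'⟩ := hproj
  have hbz : (2 : ℤ) ≤ b := by exact_mod_cast hb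
  have hfit' : ((2 * R' + 2 * r + 5 : ℕ) : ℤ) ≤ N := by exact_mod_cast hfit
  push_cast at ht0 hz0 hc' hfit'
  have ht0' : ((R' : ℤ) + 3) ≤ t ⟨0, hd0⟩ ∧ t ⟨0, hd0⟩ ≤ (R' : ℤ) + 2 * r + 3 := by omega
  -- `0 < y₀ - z₀ < N b`, contradicting `N b ∣ y₀ - z₀`
  have hlow : 0 < y ⟨0, hd0⟩ - z ⟨0, hd0⟩ := by nlinarith
  have hupp : y ⟨0, hd0⟩ - z ⟨0, hd0⟩ < N * b := by nlinarith
  have hNb : (0 : ℤ) < N * b := by nlinarith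
  have h1 : 0 < c' := by nlinarith
  have h2 : c' < 1 := by nlinarith
  omega

/-- **The far bound in the `+`-exterior box** (the chessboard–Peierls estimate transferred by DLR–FKG):
in the volume `Λ^int_{R'}` with the boundary condition `η_p = signedCoreAnnulusBC d b p R' R' 1 1` of
`VEFS1993_plusPhase` (`d ≥ 2`, `b ≥ 2`, `β ≥ 0` with `2^{b^d} e^{-β/4^d} ≤ 1`, torus side `N = 2^(n+1)`
with `N ≥ 2R' + 2r + 5` and `2(2r+1)^d ε_blk ≤ 1/3`), the probability that a `-` path of internal spins
joins a neighbour of the origin to sup-distance `> b(m'+2)` is at most three times the contour sum.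
[cite: FriedliVelenik2017, §10.4.2] [cite: VanenterFernandezSokal1993, §4.3.1 Step 2 and §4.3.2] -/
theorem isingExpect_farInd_le {n : ℕ} (hd : 2 ≤ d) (hNn : N = 2 ^ (n + 1)) (hN3 : 3 ≤ N) (hb : 2 ≤ b) (p : ℤˣ)
    {β : ℝ} (hβ : 0 ≤ β) (hρ : (2 : ℝ) ^ (b ^ d) * Real.exp (-β / 4 ^ d) ≤ 1) (R' m' r : ℕ)
    (hfit : 2 * R' + 2 * r + 5 ≤ N) (hsmall : 2 * ((2 * r + 1) ^ d : ℕ) * epsBlk d b β ≤ 1 / 3) :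
    isingExpect (zdGraph d) (spacingIntVolume d b R') β 0 (.fixed (signedCoreAnnulusBC d b p R' R' 1 1))
        (farInd (spacingIntVolume d b R') (b * (m' + 2))) ≤
      3 * ∑ W ∈ famA d N ∪ famB d N m' ∪ famC d N r (cubeCenter d (by omega) R' r), epsBlk d b β ^ #W := by
  have hN : Even N := hNn ▸ Nat.even_pow.2 ⟨even_two, Nat.succ_ne_zero n⟩
  have hd0 : 0 < d := by omega
  set y₀ := cubeCenter d hd0 R' r with hy₀
  set D := ballBlocks d y₀ r with hD
  set Λ := spacingIntVolume d b R' with hΛ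
  set F : SpinConfig (TorusSite d (N * b)) → ℝ := plusAllInd N b hd0 D with hF
  set A := isingExpect (zdGraph d) Λ β 0 (.fixed (signedCoreAnnulusBC d b p R' R' 1 1)) (farInd Λ (b * (m' + 2))) with hA
  set S := ∑ W ∈ famA d N ∪ famB d N m' ∪ famC d N r y₀, epsBlk d b β ^ #W with hS
  have hΛint : ∀ y ∈ Λ, ¬ IsSpImageSite d b y := fun y hy => (mem_spacingIntVolume.1 hy).2
  -- DLR–FKG comparison
  have hbig : 2 * (b * R' + 1) < N * b := by nlinarith
  have hcmp := isingExpect_mul_tExpect_le (d := d) hN hb hβ p R' hbig (g := farInd Λ (b * (m' + 2)))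
    (farInd_antitone Λ _) (fun σ σ' h => farInd_congr _ h) (F := F) (fun σ => plusAllInd_nonneg hd0 D σ)
    (fun σ σ' h => plusAllInd_ballBlocks_local hd hb R' r hfit h)
  -- the torus bound
  have htorus : tExpect N b p β (fun σ' => farInd Λ (b * (m' + 2)) (σ' ∘ Torus.proj (N * b)) * F σ') ≤ S :=
    tExpect_farInd_mul_plusAllInd_le hd hNn hN3 hb p hβ hρ hΛint m' r y₀
  -- the plus cube is likely
  have hcube : 1 / 3 ≤ tExpect N b p β F := by
    have h := tExpect_plusAllInd_ge hd hNn hN3 hb p hβ hρ (D := D) ⟨0, hd0⟩ (((R' + r + 3 : ℕ) : ℤ) + 1)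
      (starConn_ballBlocks_union y₀ r ⟨0, hd0⟩) (ballBlocks_image_reflect hd0 R' r)
    rw [hD, card_ballBlocks] at h
    have : ((#(ballBlocks d y₀ r) : ℕ) : ℝ) = ((2 * r + 1) ^ d : ℕ) := by rw [card_ballBlocks]
    push_cast at h hsmall this
    rw [card_ballBlocks] at *
    push_cast at *
    linarith
  have hA0 : 0 ≤ A := isingExpect_nonneg_of_nonneg _ _ _ _ _ fun σ => farInd_nonneg Λ _ σ
  calc A = 3 * (A * (1 / 3)) := by ring
    _ ≤ 3 * (A * tExpect N b p β F) := by gcongr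
    _ ≤ 3 * S := by linarith [hcmp.trans htorus]

end FarBound

end Literature.Barriers.CriticalPhenomena.NonGibbs

end
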